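import Literature.NumberTheory.LFunctions.RealZerosPintzContinuation
import Literature.NumberTheory.LFunctions.LandauPageRealZeros
import Literature.NumberTheory.LFunctions.DirichletLOneLogBound
import Literature.NumberTheory.Sieve.FriedlanderIwaniecPrimesJacobiTwistedLemmas
import Literature.NumberTheory.Sieve.DivisorBound
import Mathlib.Analysis.SumIntegralComparisons
import HarnessLib

/-!
# Pintz 1977 (VIII), Theorem 5 — Landau's theorem with `c′ = 1 + o(1)` — PROVED, with Pintz's
# Lemma 1 (the iterated hyperbola method) for `F(s, χ₁, χ₂) = ζ(s)L(s,χ₁)L(s,χ₂)L(s,χ₁χ₂)`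

Topic `Literature/NumberTheory/LFunctions` (namespace `Literature.NumberTheory.LFunctions`, helpers
in the grouping sub-namespace `Pintz1977RealZeros`). PROOF LAYER for the statement file
`RealZerosRealLFunctionsElementary.lean` (cells `parity-realchar` / `landau-siegel` §C); sequel of
`RealZerosPintzContinuation.lean` (Theorem 4 and the engine = Pintz's Lemmata 2–3 + §4). The named fact

* `pintz1977RealZeros_theorem5` — J. Pintz, *Elementary methods in the theory of `L`-functions,
  VIII. Real zeros of real `L`-functions*, Acta Arith. **33** (1977) 89–98, Theorem 5 (Landau): "If
  `χ₁ ≠ χ₂` are real primitive characters `(mod D₁)` and `(mod D₂)` resp. and for real `δ₁, δ₂`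
  `L(1 − δ₁, χ₁) = L(1 − δ₂, χ₂) = 0` then `max(δ₁, δ₂) > c′/log D₁D₂`, where … `c′ = 1 + o(1)` if
  we use [the Pólya–Vinogradov inequality]" (typed: `∀ η > 0 ∃ A₀ ∀ D₁D₂ ≥ A₀ …
  (1 − η)/log(D₁D₂) < max δ₁ δ₂`)

is discharged here as `theorem pintz1977RealZeros_theorem5_holds : pintz1977RealZeros_theorem5`.
The statement file is untouched; the typed `Prop` is proved literally. Everything in this file is
PROVED (theorems only; no definition, no named fact).

## Source and road (as printed, §3 Lemma 1 and §4, pp. 91–96)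

Source READ first-hand in the proving seat: the journal scan `matwbn.icm.edu.pl/ksiazki/aa/aa33/aa3318.pdf`
(corpus `paper:url-e87e20b34ffd`; Theorem 5 p. 90, Lemma 1 (3.1)–(3.10) pp. 91–93, proof of
Theorems 4–5 p. 96).

PRINT (p. 96): "If the function `F(s)` satisfies the conditions of Lemma 3, further `a > 0`,
`f(m) ≥ 0` and `f(4) ≥ 1`, then `F(s)` has at most one, simple zero in the interval
`[1 − (1 − o(1))/log A, 1]` … Applying this … for `F(s) = F(s, χ₁, χ₂)` we get Theorem 5 (with the
constants `c′ = 1/2 + o(1)` and `c′ = 1 + o(1)` resp.)"; p. 95: "`F₃(s) = F(s, χ₁, χ₂) =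
ζ(s)L(s,χ₁)L(s,χ₂)L(s,χ₁χ₂)`, … `χ₁χ₂` a real non-principal character, … in case `j = 3`,
`a = L(1,χ₁)L(1,χ₂)L(1,χ₁χ₂)`"; Lemma 1 (p. 91): for `|θ_i| = O(1)`, `|∑_{d ≤ n} θ_i(d)| ≤ A_i`,
`A = ∏ A_i`, `f = θ₀ ∗ θ₁ ∗ ⋯ ∗ θ_j` (`θ₀ = 1`): `∑_{m ≤ y} f(m) = y{∏ L_i(1) + O((A/y)^{1/(j+1)} log^{j−1} y)}`
for `y ≥ A`, proved by induction on `j` through (3.10) with `z = (y A_j^j (∏_{i<j} A_i)^{−1})^{1/(j+1)}`.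

HERE, in the same order:

* **Part A (Lemma 1, the induction step (3.10)).** For arithmetic functions `θ` (`|θ| ≤ 1`, partial
  sums `≤ A`, `|L − ∑_{n ≤ N} θ(n)/n| ≤ 2A/(N+1)`) and `g` (`∑_{n ≤ y} g(n) = b y + O(B y^β (1+log y)^k)`
  for `y ≥ Y₀`), and `z ≥ 1` with `z Y₀ ≤ y`:
  `|∑_{n ≤ y} (θ ∗ g)(n) − bL y| ≤ 2A|b|y/(z+1) + B y^β(1+log y)^k z^{1−β}/(1−β) + 2A ∑_{n ≤ y/z}|g(n)|`
  (`norm_summatory_mul_sub_le`; Dirichlet's hyperbola method, Mathlib `sum_Ioc_mul_eq_sum_sum`).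
* **Part B (Lemma 1 for `j = 1, 2, 3`).** `j = 1` is Part C of `RealZerosPintzContinuation`
  (`5√(A₁y)`); `j = 2` with `z = (yA₂²/A₁)^{1/3}` gives `16 ℓ (A₁A₂)^{1/3} y^{2/3}(1 + log y)` for
  `y ≥ A₁A₂` (`norm_summatory_two_sub_le`); `j = 3` with `z = (yA₃³/(A₁A₂))^{1/4}` gives
  `54 ℓ² (A₁A₂A₃)^{1/4} y^{3/4} (1 + log y)²` for `y ≥ A₁A₂A₃` (`norm_summatory_three_sub_le`), where
  `ℓ ≥ |L(1, χ_i)|`; the trivial majorants `∑_{n ≤ T}|(ζ∗χ₁)(n)| ≤ T(1+log T)`,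
  `∑_{n ≤ T} |(ζ∗χ₁∗χ₂)(n)| ≤ T(1 + log T)²` replace the printed (3.4). The coefficient sequence is the
  tree's `SiegelCoefficients.coeff χ₁ χ₂ = χ₁χ₂ ∗ (χ₂ ∗ (ζ ∗ χ₁))` (`norm_summatory_coeff_sub_le`).
* **Part C (§4 for `F(s, χ₁, χ₂)`).** `r(n) ≥ 0` (tree `coeff_nonneg`, MV p. 285), `r(4) ≥ 1`
  (`one_le_re_coeff_four`, casework on `χ₁(2), χ₂(2)`), `a = L(1,χ₁)L(1,χ₂)L(1,χ₁χ₂) > 0`,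
  `G = ζ₁ · L(χ₁)L(χ₂)L(χ₁χ₂)` entire with `G = (s−1)∑ r(n)n^{−s}` (tree `LSeries_coeff_eq`); the
  engine of `RealZerosPintzContinuation` (`continuation_eq`, `hasDerivAt_continuation`, `re_deriv_le`
  with `κ = 1/4 − δ`, `eq_of_zeros_of_re_deriv_neg`) gives `Re F′(σ) < 0` on `[1 − 1/log N, 1)`
  (`landau_hasDerivAt_re_neg`) and hence (`landau_window`): `L(s,χ₁)` and `L(s,χ₂)` cannot both
  vanish at real points of the window — two distinct zeros of `F` contradict Rolle, a common zero
  `β` would give `F′(β) = 0`.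
* **Part D–E (Theorem 5).** `N = ⌊(D₁D₂)^{1/(1−η)}⌋` (so `1/log N ≥ (1−η)/log D₁D₂`), the bounds
  `A₁ = √D₁(1 + log D₁D₂)`, `A₂ = √D₂(1 + log D₁D₂)` (tree Pólya–Vinogradov),
  `A₃ = τ(D₁D₂)√(D₁D₂)(1 + log D₁D₂)` (tree Pólya–Vinogradov for the possibly imprimitive
  `χ₁χ₂ mod D₁D₂`, `FriedlanderIwaniecPrimes.norm_sum_Ioc_le_of_ne_one`), `|L(1,χ)| ≤ log q` (tree),
  the divisor bound `τ(n) ≤ C n^{η/64}` (tree `DivisorBound`) and the elementary limits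
  `(1 + log x)/x^u → 0` give `A₀(η)`; `χ₁χ₂ ≠ χ₀` from "`χ₁ ≠ χ₂`" (typed as distinct value
  functions; tree `DirichletZFR.prodChar_ne_one_of_isPrimitive` when `D₁ ≠ D₂`).

DECLARED DEVIATIONS from print: (i) the window is parametrised by `N` with `1/log N` in place of
`x = A^{1+ε}` — the same inequality (4.5); (ii) the partial-sum bounds are the tree's explicit
`√q(1 + log q)` (and `τ(q)√q(1 + log q)` for the product character, which the print does not
discuss) rather than `2√D log D` — any `A = (D₁D₂)^{1+o(1)}` gives `c′ = 1 + o(1)`; (iii) the error of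
Lemma 1 is carried with explicit constants (`54 ℓ² A^{1/4} y^{3/4}(1 + log y)²`), the remainder term
(3.4) being replaced by the trivial divisor-type majorant, and `log² y ≤ (16/δ²) y^δ`, `δ = η/64`,
converts it to the power form `B y^{1−κ}`, `κ = 1/4 − δ`, of the engine; (iv) `A₀(η)` is obtained
from limits, not computed; (v) the typed hypotheses admit the principal character mod `1`
(primitive and quadratic), for which `L = ζ` and a real zero `1 − δ` has `δ > 1` (`ζ(σ) ≠ 0` for
`σ ≥ 0`): this degenerate case is settled separately. No constant of the printed statement is
changed: `c′ = 1 + o(1)` is proved exactly as typed (`∀ η > 0 ∃ A₀`).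

WHAT THIS IS NOT: no claim that any real zero exists or does not exist; nothing here bears on parity
or on Landau–Siegel zeros beyond Landau's classical repulsion theorem. «The programme SEARCHES and
TYPES; no claim about Landau–Siegel zeros, Theorems 1–2 of arXiv:2211.02515 or a repaired Margin232
until a kernel theorem says so.»

## References

* [Pintz1977ElementaryVIII] J. Pintz, Acta Arith. 33 (1977) 89–98: Theorem 5 p. 90; Lemma 1
  (3.1)–(3.10) pp. 91–93; §4 pp. 94–96, (4.5).
* [MontgomeryVaughan2007] H. L. Montgomery, R. C. Vaughan, *Multiplicative Number Theory I*, CUP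
  2007: §9.4 (Pólya–Vinogradov), §11.2 p. 285 (the coefficients of `ζ L₁ L₂ L₃`), §11.2.1 Exercise 3.
* [HardyWright2008] G. H. Hardy, E. M. Wright, *An Introduction to the Theory of Numbers*, Thm 315
  (`d(n) = O(n^δ)`; tree `DivisorBound`).
-/

noncomputable section

open Complex Filter Topology Set MeasureTheory Finset Asymptotics ArithmeticFunction
open scoped ArithmeticFunction.zeta

namespace Literature.NumberTheory.LFunctions

namespace Pintz1977RealZeros

/-! ## Part A. Pintz's Lemma 1: the induction step (3.10) of the hyperbola method, with
explicit constants -/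

section HyperbolaStep

/-- Interval sums from a partial-sum bound: `‖∑_{z < n ≤ M} θ(n)‖ ≤ 2A`. [folklore] -/
private theorem norm_sum_Ioc_le_two_mul {θ : ℕ → ℂ} {A : ℝ}
    (hA : ∀ N : ℕ, ‖∑ n ∈ Ioc 0 N, θ n‖ ≤ A) (z M : ℕ) :
    ‖∑ n ∈ Ioc z M, θ n‖ ≤ 2 * A := by
  have hA0 : 0 ≤ A := (norm_nonneg _).trans (hA 0)
  rcases le_or_gt M z with h | h
  · rw [Finset.Ioc_eq_empty (not_lt.mpr h), sum_empty, norm_zero]; linarith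
  · have hsplit := sum_Ioc_consecutive θ (Nat.zero_le z) h.le
    have : ∑ n ∈ Ioc z M, θ n = ∑ n ∈ Ioc 0 M, θ n - ∑ n ∈ Ioc 0 z, θ n := by
      rw [← hsplit]; ring
    rw [this]
    exact (norm_sub_le _ _).trans (by linarith [hA M, hA z])

/-- `∑_{d ≤ z} d^{−β} ≤ z^{1−β}/(1 − β)` for `0 ≤ β < 1`, `z ≥ 1` (comparison with
`∫_1^z x^{−β} dx`). [folklore] -/
private theorem sum_Ioc_rpow_neg_le {β : ℝ} (hβ0 : 0 ≤ β) (hβ1 : β < 1) {z : ℕ} (hz : 1 ≤ z) :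
    ∑ d ∈ Ioc 0 z, (d : ℝ) ^ (-β) ≤ (z : ℝ) ^ (1 - β) / (1 - β) := by
  have h1β : 0 < 1 - β := by linarith
  obtain ⟨m, rfl⟩ : ∃ m, z = m + 1 := ⟨z - 1, by omega⟩
  have hanti : AntitoneOn (fun x : ℝ => x ^ (-β)) (Set.Icc (1 : ℝ) (1 + m)) := by
    refine (Real.antitoneOn_rpow_Ioi_of_exponent_nonpos (by linarith : -β ≤ 0)).mono ?_
    intro x hx
    exact lt_of_lt_of_le one_pos hx.1
  have hint := AntitoneOn.sum_le_integral hanti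
  have hI : ∫ x in (1 : ℝ)..1 + m, x ^ (-β) = ((1 + (m : ℝ)) ^ (1 - β) - 1) / (1 - β) := by
    rw [integral_rpow (Or.inl (by linarith : (-1 : ℝ) < -β)), show -β + 1 = 1 - β by ring,
      Real.one_rpow]
  have hsum : ∑ d ∈ Ioc 0 (m + 1), (d : ℝ) ^ (-β) =
      1 + ∑ i ∈ Finset.range m, (1 + ((i + 1 : ℕ) : ℝ)) ^ (-β) := by
    rw [DirichletAbel.sum_Ioc_eq_sum_range_succ, Finset.sum_range_succ', add_comm]
    congr 1
    · simp
    · refine sum_congr rfl fun i _ => ?_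
      push_cast; ring_nf
  rw [hsum]
  rw [hI] at hint
  have hkey : 1 + ((1 + (m : ℝ)) ^ (1 - β) - 1) / (1 - β) =
      (1 + (m : ℝ)) ^ (1 - β) / (1 - β) - β / (1 - β) := by
    field_simp; ring
  have hβd : 0 ≤ β / (1 - β) := div_nonneg hβ0 h1β.le
  have hcast : (((m + 1 : ℕ) : ℝ)) = 1 + (m : ℝ) := by push_cast; ring
  rw [hcast]
  linarith

/-- `∑_{n ≤ N} 1/n ≤ 1 + log N`. [folklore] -/
private theorem sum_Ioc_inv_le_log (N : ℕ) : ∑ d ∈ Ioc 0 N, (d : ℝ)⁻¹ ≤ 1 + Real.log N := by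
  have h := harmonic_le_one_add_log N
  rw [harmonic_eq_sum_Icc] at h
  push_cast at h
  rwa [show Finset.Ioc 0 N = Finset.Icc 1 N by
    ext; simp only [Finset.mem_Ioc, Finset.mem_Icc]; omega]

/-- Norms of a convolution with a bounded multiplier, on average: if `‖θ‖ ≤ 1` and
`∑_{n ≤ T} ‖g(n)‖ ≤ M T (1 + log T)^j` for `T ≥ 1`, then `∑_{n ≤ T} ‖(θ ∗ g)(n)‖ ≤ M T (1 + log T)^{j+1}`
for `T ≥ 1` (the trivial form of Pintz's (3.4)). [folklore] -/
private theorem sum_norm_mul_le (θ g : ArithmeticFunction ℂ) (hθ1 : ∀ n, ‖θ n‖ ≤ 1)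
    {M : ℝ} {j : ℕ}
    (hM : ∀ T : ℝ, 1 ≤ T → ∑ n ∈ Ioc 0 ⌊T⌋₊, ‖g n‖ ≤ M * T * (1 + Real.log T) ^ j)
    {T : ℝ} (hT : 1 ≤ T) :
    ∑ n ∈ Ioc 0 ⌊T⌋₊, ‖(θ * g) n‖ ≤ M * T * (1 + Real.log T) ^ (j + 1) := by
  set N := ⌊T⌋₊ with hN
  have hT0 : 0 < T := by linarith
  have hlogT : 0 ≤ Real.log T := Real.log_nonneg hT
  have hN1 : 1 ≤ N := Nat.le_floor (by simpa using hT)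
  have hNT : (N : ℝ) ≤ T := Nat.floor_le hT0.le
  have hM0 : 0 ≤ M := by
    have h := hM 1 le_rfl
    rw [Nat.floor_one, Real.log_one, add_zero, one_pow, mul_one, mul_one,
      show Finset.Ioc 0 1 = ({1} : Finset ℕ) from rfl, sum_singleton] at h
    exact (norm_nonneg _).trans h
  -- majorants as real arithmetic functions
  set θ' : ArithmeticFunction ℝ := ⟨fun n => ‖θ n‖, by simp⟩ with hθ'
  set g' : ArithmeticFunction ℝ := ⟨fun n => ‖g n‖, by simp⟩ with hg'
  have h1 : ∀ n, ‖(θ * g) n‖ ≤ (θ' * g') n := by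
    intro n
    rw [mul_apply, mul_apply]
    refine (norm_sum_le _ _).trans (le_of_eq (sum_congr rfl fun x _ => ?_))
    rw [norm_mul]; rfl
  have h2 : ∑ n ∈ Ioc 0 N, (θ' * g') n = ∑ d ∈ Ioc 0 N, ‖θ d‖ * ∑ e ∈ Ioc 0 (N / d), ‖g e‖ := by
    rw [sum_Ioc_mul_eq_sum_sum]; rfl
  have h3 : ∀ d ∈ Finset.Ioc 0 N, ‖θ d‖ * ∑ e ∈ Ioc 0 (N / d), ‖g e‖ ≤
      M * T * (1 + Real.log T) ^ j * (d : ℝ)⁻¹ := by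
    intro d hd
    obtain ⟨hd0, hdN⟩ := Finset.mem_Ioc.mp hd
    have hd0r : (0 : ℝ) < d := by exact_mod_cast hd0
    have hTd : 1 ≤ T / d := by
      rw [le_div_iff₀ hd0r, one_mul]
      exact le_trans (by exact_mod_cast hdN) hNT
    have h := hM (T / d) hTd
    rw [Nat.floor_div_natCast, ← hN] at h
    have hlog : (1 + Real.log (T / d)) ^ j ≤ (1 + Real.log T) ^ j := by
      apply pow_le_pow_left₀ (by linarith [Real.log_nonneg hTd])
      have h1 : Real.log (T / d) = Real.log T - Real.log d := Real.log_div hT0.ne' hd0r.ne'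
      have h2 : 0 ≤ Real.log d := Real.log_nonneg (by exact_mod_cast hd0)
      linarith
    have hsum0 : 0 ≤ ∑ e ∈ Ioc 0 (N / d), ‖g e‖ := sum_nonneg fun _ _ => norm_nonneg _
    calc ‖θ d‖ * ∑ e ∈ Ioc 0 (N / d), ‖g e‖ ≤ 1 * (M * (T / d) * (1 + Real.log (T / d)) ^ j) :=
          mul_le_mul (hθ1 d) h hsum0 zero_le_one
      _ ≤ 1 * (M * (T / d) * (1 + Real.log T) ^ j) := by
          have : 0 ≤ M * (T / d) := by positivity
          exact mul_le_mul_of_nonneg_left (mul_le_mul_of_nonneg_left hlog this) zero_le_one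
      _ = M * T * (1 + Real.log T) ^ j * (d : ℝ)⁻¹ := by ring
  have hlogN : Real.log N ≤ Real.log T :=
    Real.log_le_log (by exact_mod_cast (lt_of_lt_of_le zero_lt_one hN1)) hNT
  calc ∑ n ∈ Ioc 0 N, ‖(θ * g) n‖ ≤ ∑ n ∈ Ioc 0 N, (θ' * g') n := sum_le_sum fun n _ => h1 n
    _ = ∑ d ∈ Ioc 0 N, ‖θ d‖ * ∑ e ∈ Ioc 0 (N / d), ‖g e‖ := h2
    _ ≤ ∑ d ∈ Ioc 0 N, M * T * (1 + Real.log T) ^ j * (d : ℝ)⁻¹ := sum_le_sum h3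
    _ = M * T * (1 + Real.log T) ^ j * ∑ d ∈ Ioc 0 N, (d : ℝ)⁻¹ := by rw [mul_sum]
    _ ≤ M * T * (1 + Real.log T) ^ j * (1 + Real.log T) := by
        refine mul_le_mul_of_nonneg_left ((sum_Ioc_inv_le_log N).trans (by linarith)) ?_
        positivity
    _ = M * T * (1 + Real.log T) ^ (j + 1) := by ring

/-- Exchange of summation in the hyperbola tail:
`∑_{z < d ≤ N} θ(d) ∑_{e ≤ N/d} g(e) = ∑_{e ≤ N} g(e) ∑_{z < d ≤ N/e} θ(d)`. [folklore] -/
private theorem sum_Ioc_mul_sum_eq (θ g : ℕ → ℂ) (z N : ℕ) :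
    ∑ d ∈ Ioc z N, θ d * ∑ e ∈ Ioc 0 (N / d), g e =
      ∑ e ∈ Ioc 0 N, g e * ∑ d ∈ Ioc z (N / e), θ d := by
  have key : ∀ d ∈ Finset.Ioc z N, ∑ e ∈ Ioc 0 (N / d), g e =
      ∑ e ∈ Ioc 0 N, if d * e ≤ N then g e else 0 := by
    intro d hd
    have hd0 : 0 < d := lt_of_le_of_lt (Nat.zero_le z) (Finset.mem_Ioc.mp hd).1
    rw [← sum_filter]
    congr 1
    ext e
    simp only [Finset.mem_Ioc, Finset.mem_filter]
    constructor
    · rintro ⟨he0, he⟩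
      have h1 : e * d ≤ N := (Nat.le_div_iff_mul_le hd0).mp he
      exact ⟨⟨he0, le_trans (Nat.le_mul_of_pos_right e hd0) h1⟩, by rwa [mul_comm] at h1⟩
    · rintro ⟨⟨he0, -⟩, h⟩
      exact ⟨he0, (Nat.le_div_iff_mul_le hd0).mpr (by rwa [mul_comm] at h)⟩
  have key' : ∀ e ∈ Finset.Ioc 0 N, ∑ d ∈ Ioc z (N / e), θ d =
      ∑ d ∈ Ioc z N, if d * e ≤ N then θ d else 0 := by
    intro e he
    have he0 : 0 < e := (Finset.mem_Ioc.mp he).1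
    rw [← sum_filter]
    congr 1
    ext d
    simp only [Finset.mem_Ioc, Finset.mem_filter]
    constructor
    · rintro ⟨hdz, hd⟩
      have h1 : d * e ≤ N := (Nat.le_div_iff_mul_le he0).mp hd
      exact ⟨⟨hdz, le_trans (Nat.le_mul_of_pos_right d he0) h1⟩, h1⟩
    · rintro ⟨⟨hdz, -⟩, h⟩
      exact ⟨hdz, (Nat.le_div_iff_mul_le he0).mpr h⟩
  calc ∑ d ∈ Ioc z N, θ d * ∑ e ∈ Ioc 0 (N / d), g e
      = ∑ d ∈ Ioc z N, ∑ e ∈ Ioc 0 N, (if d * e ≤ N then θ d * g e else 0) := by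
        refine sum_congr rfl fun d hd => ?_
        rw [key d hd, mul_sum]
        refine sum_congr rfl fun e _ => ?_
        split_ifs <;> simp
    _ = ∑ e ∈ Ioc 0 N, ∑ d ∈ Ioc z N, (if d * e ≤ N then θ d * g e else 0) := sum_comm
    _ = ∑ e ∈ Ioc 0 N, g e * ∑ d ∈ Ioc z (N / e), θ d := by
        refine sum_congr rfl fun e he => ?_
        rw [key' e he, mul_sum]
        refine sum_congr rfl fun d _ => ?_
        split_ifs <;> simp [mul_comm]

/-- **Pintz's Lemma 1, the induction step (3.10)** (Dirichlet's hyperbola method with a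
partial-sum bound). Let `θ` be bounded, `|θ| ≤ 1`, with partial sums `|∑_{n ≤ N} θ(n)| ≤ A` and
`|L − ∑_{n ≤ N} θ(n)/n| ≤ 2A/(N+1)` (`L = ∑ θ(n)/n`); let `g` have summatory function
`∑_{n ≤ y} g(n) = b y + O(B_g y^β (1 + log y)^k)` for `y ≥ Y₀ ≥ 1`. Then for `z ≥ 1`, `z Y₀ ≤ y`:
`|∑_{n ≤ y} (θ ∗ g)(n) − b L y| ≤ 2A|b| y/(z+1) + B_g y^β (1+log y)^k z^{1−β}/(1−β) + 2A ∑_{n ≤ y/z} |g(n)|`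
— the three printed terms `O(y ∏L_i · A_j/z)`, `O(∑_{d_j ≤ z} (…)(y/d_j)^{1−1/j} log^{j−2})`,
`O(A_j log^{j−1} y · y/z)` of (3.10), p. 93. [cite: Pintz1977ElementaryVIII, Lemma 1 (3.10) pp. 92–93] -/
theorem norm_summatory_mul_sub_le (θ g : ArithmeticFunction ℂ) {A Bg β Y₀ : ℝ} {k : ℕ}
    {b L : ℂ} (hθ1 : ∀ n, ‖θ n‖ ≤ 1) (hA : ∀ N : ℕ, ‖∑ n ∈ Ioc 0 N, θ n‖ ≤ A)
    (hL : ∀ N : ℕ, ‖L - ∑ n ∈ Ioc 0 N, θ n / n‖ ≤ 2 * A / ((N : ℝ) + 1))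
    (hY₀ : 1 ≤ Y₀) (hβ0 : 0 ≤ β) (hβ1 : β < 1)
    (hg : ∀ y : ℝ, Y₀ ≤ y →
      ‖∑ n ∈ Ioc 0 ⌊y⌋₊, g n - b * y‖ ≤ Bg * y ^ β * (1 + Real.log y) ^ k)
    {y : ℝ} {z : ℕ} (hz : 1 ≤ z) (hzy : (z : ℝ) * Y₀ ≤ y) :
    ‖∑ n ∈ Ioc 0 ⌊y⌋₊, (θ * g) n - b * L * y‖ ≤
      2 * A * ‖b‖ * y / ((z : ℝ) + 1)
        + Bg * y ^ β * (1 + Real.log y) ^ k * ((z : ℝ) ^ (1 - β) / (1 - β))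
        + 2 * A * ∑ n ∈ Ioc 0 ⌊y / z⌋₊, ‖g n‖ := by
  set N := ⌊y⌋₊ with hN
  have hz0 : (0 : ℝ) < z := by exact_mod_cast hz
  have hz1 : (1 : ℝ) ≤ z := by exact_mod_cast hz
  have hzy' : (z : ℝ) ≤ y := le_trans (by nlinarith) hzy
  have hy1 : 1 ≤ y := hz1.trans hzy'
  have hy0 : 0 < y := by linarith
  have hzN : z ≤ N := Nat.le_floor hzy'
  have hA0 : 0 ≤ A := (norm_nonneg _).trans (hA 0)
  have hlogy : 0 ≤ Real.log y := Real.log_nonneg hy1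
  have hBg0 : 0 ≤ Bg := by
    have h := (norm_nonneg _).trans (hg Y₀ le_rfl)
    have h1 : 0 < Y₀ ^ β * (1 + Real.log Y₀) ^ k := by
      have := Real.log_nonneg hY₀
      positivity
    by_contra hneg
    push Not at hneg
    have : Bg * Y₀ ^ β * (1 + Real.log Y₀) ^ k < 0 := by
      rw [mul_assoc]; exact mul_neg_of_neg_of_pos hneg h1
    linarith
  -- the summatory function of `g`
  set G : ℕ → ℂ := fun m => ∑ e ∈ Ioc 0 m, g e with hG
  have hre : ∑ n ∈ Ioc 0 N, (θ * g) n = ∑ d ∈ Ioc 0 N, θ d * G (N / d) := by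
    rw [sum_Ioc_mul_eq_sum_sum]
  -- Part 1: `d ≤ z`
  have hGd : ∀ d ∈ Finset.Ioc 0 z, ‖θ d * G (N / d) - b * (y / d) * θ d‖ ≤
      Bg * y ^ β * (1 + Real.log y) ^ k * (d : ℝ) ^ (-β) := by
    intro d hd
    obtain ⟨hd0, hdz⟩ := Finset.mem_Ioc.mp hd
    have hd0r : (0 : ℝ) < d := by exact_mod_cast hd0
    have hyd : Y₀ ≤ y / d := by
      rw [le_div_iff₀ hd0r]
      calc Y₀ * d ≤ Y₀ * z := by gcongr
        _ = z * Y₀ := mul_comm _ _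
        _ ≤ y := hzy
    have h := hg (y / d) hyd
    rw [Nat.floor_div_natCast, ← hN] at h
    push_cast at h
    have hyd1 : 1 ≤ y / d := hY₀.trans hyd
    have hlog : (1 + Real.log (y / d)) ^ k ≤ (1 + Real.log y) ^ k := by
      apply pow_le_pow_left₀ (by linarith [Real.log_nonneg hyd1])
      have h1 : Real.log (y / d) = Real.log y - Real.log d := Real.log_div hy0.ne' hd0r.ne'
      have h2 : 0 ≤ Real.log d := Real.log_nonneg (by exact_mod_cast hd0)
      linarith
    have hpow : (y / d) ^ β = y ^ β * (d : ℝ) ^ (-β) := by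
      rw [Real.div_rpow hy0.le hd0r.le, Real.rpow_neg hd0r.le, div_eq_mul_inv]
    calc ‖θ d * G (N / d) - b * (y / d) * θ d‖ = ‖θ d‖ * ‖G (N / d) - b * (y / d)‖ := by
          rw [← norm_mul]; congr 1; ring
      _ ≤ 1 * (Bg * (y / d) ^ β * (1 + Real.log (y / d)) ^ k) :=
          mul_le_mul (hθ1 d) h (norm_nonneg _) zero_le_one
      _ ≤ Bg * y ^ β * (1 + Real.log y) ^ k * (d : ℝ) ^ (-β) := by
          rw [one_mul, hpow]
          have h0 : 0 ≤ Bg * (y ^ β * (d : ℝ) ^ (-β)) := by positivity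
          calc Bg * (y ^ β * (d : ℝ) ^ (-β)) * (1 + Real.log (y / d)) ^ k
              ≤ Bg * (y ^ β * (d : ℝ) ^ (-β)) * (1 + Real.log y) ^ k :=
                mul_le_mul_of_nonneg_left hlog h0
            _ = _ := by ring
  have hsum1 : ∑ d ∈ Ioc 0 z, θ d * G (N / d) - b * L * y =
      ∑ d ∈ Ioc 0 z, (θ d * G (N / d) - b * (y / d) * θ d) +
        b * y * (∑ d ∈ Ioc 0 z, θ d / d - L) := by
    rw [sum_sub_distrib, mul_sub, mul_sum]
    have : ∑ d ∈ Ioc 0 z, b * (y / d) * θ d = ∑ d ∈ Ioc 0 z, b * y * (θ d / d) :=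
      sum_congr rfl fun d _ => by ring
    rw [this]; ring
  have hP1 : ‖∑ d ∈ Ioc 0 z, θ d * G (N / d) - b * L * y‖ ≤
      2 * A * ‖b‖ * y / ((z : ℝ) + 1) +
        Bg * y ^ β * (1 + Real.log y) ^ k * ((z : ℝ) ^ (1 - β) / (1 - β)) := by
    rw [hsum1]
    refine (norm_add_le _ _).trans ?_
    have hfirst : ‖∑ d ∈ Ioc 0 z, (θ d * G (N / d) - b * (y / d) * θ d)‖ ≤
        Bg * y ^ β * (1 + Real.log y) ^ k * ((z : ℝ) ^ (1 - β) / (1 - β)) := by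
      refine (norm_sum_le _ _).trans ((sum_le_sum hGd).trans ?_)
      rw [← mul_sum]
      exact mul_le_mul_of_nonneg_left (sum_Ioc_rpow_neg_le hβ0 hβ1 hz) (by positivity)
    have hsecond : ‖b * y * (∑ d ∈ Ioc 0 z, θ d / d - L)‖ ≤ 2 * A * ‖b‖ * y / ((z : ℝ) + 1) := by
      rw [norm_mul, norm_mul, norm_sub_rev, Complex.norm_real, Real.norm_of_nonneg hy0.le]
      calc ‖b‖ * y * ‖L - ∑ d ∈ Ioc 0 z, θ d / d‖ ≤ ‖b‖ * y * (2 * A / ((z : ℝ) + 1)) :=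
            mul_le_mul_of_nonneg_left (hL z) (by positivity)
        _ = 2 * A * ‖b‖ * y / ((z : ℝ) + 1) := by ring
    linarith
  -- Part 2: `d > z`
  have hP2 : ‖∑ d ∈ Ioc z N, θ d * G (N / d)‖ ≤ 2 * A * ∑ n ∈ Ioc 0 ⌊y / z⌋₊, ‖g n‖ := by
    have hex : ∑ d ∈ Ioc z N, θ d * G (N / d) = ∑ e ∈ Ioc 0 N, g e * ∑ d ∈ Ioc z (N / e), θ d :=
      sum_Ioc_mul_sum_eq θ g z N
    rw [hex]
    have hpt : ∀ e ∈ Finset.Ioc 0 N, ‖g e * ∑ d ∈ Ioc z (N / e), θ d‖ ≤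
        if z < N / e then 2 * A * ‖g e‖ else 0 := by
      intro e _
      split_ifs with h
      · rw [norm_mul]
        calc ‖g e‖ * ‖∑ d ∈ Ioc z (N / e), θ d‖ ≤ ‖g e‖ * (2 * A) :=
              mul_le_mul_of_nonneg_left (norm_sum_Ioc_le_two_mul hA z (N / e)) (norm_nonneg _)
          _ = 2 * A * ‖g e‖ := by ring
      · rw [Finset.Ioc_eq_empty h, sum_empty, mul_zero, norm_zero]
    refine (norm_sum_le _ _).trans ((sum_le_sum hpt).trans ?_)
    rw [← sum_filter, ← mul_sum]
    refine mul_le_mul_of_nonneg_left ?_ (by positivity)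
    refine sum_le_sum_of_subset_of_nonneg (fun e he => ?_) (fun _ _ _ => norm_nonneg _)
    rw [Finset.mem_filter, Finset.mem_Ioc] at he
    obtain ⟨⟨he0, -⟩, hze⟩ := he
    rw [Finset.mem_Ioc, Nat.floor_div_natCast, ← hN]
    refine ⟨he0, (Nat.le_div_iff_mul_le hz).mpr ?_⟩
    have := (Nat.le_div_iff_mul_le he0).mp hze.le
    rwa [mul_comm] at this
  -- assemble
  rw [hre, ← sum_Ioc_consecutive _ (Nat.zero_le z) hzN,
    show ∑ d ∈ Ioc 0 z, θ d * G (N / d) + ∑ d ∈ Ioc z N, θ d * G (N / d) - b * L * y =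
      (∑ d ∈ Ioc 0 z, θ d * G (N / d) - b * L * y) + ∑ d ∈ Ioc z N, θ d * G (N / d) by ring]
  exact (norm_add_le _ _).trans (by linarith [hP1, hP2])

end HyperbolaStep

/-! ## Part B. Lemma 1 for `j = 1, 2, 3`: the summatory function of `r = ζ ∗ χ₁ ∗ χ₂ ∗ χ₁χ₂`
(the coefficients of `ζ(s) L(s,χ₁) L(s,χ₂) L(s,χ₁χ₂)`) with partial-sum bounds `A₁, A₂, A₃` -/

section LemmaOne

open DirichletAbel RealChar SiegelCoefficients

/-- `|χ(n)| ≤ 1` for the arithmetic function of a Dirichlet character. [folklore] -/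
private theorem norm_charAF_le_one {q : ℕ} (χ : DirichletCharacter ℂ q) (n : ℕ) :
    ‖charAF χ n‖ ≤ 1 := by
  simp only [charAF, toArithmeticFunction, coe_mk]
  split_ifs
  · simp
  · exact χ.norm_le_one _

/-- The partial sums of `charAF χ` are the tree's `partialSum χ`. [folklore] -/
private theorem sum_Ioc_charAF_eq {q : ℕ} (χ : DirichletCharacter ℂ q) (N : ℕ) :
    ∑ n ∈ Ioc 0 N, charAF χ n = partialSum χ N := by
  rw [partialSum_eq_sum_Ioc, zero_add]
  refine sum_congr rfl fun n hn => ?_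
  have hn0 : n ≠ 0 := ((Finset.mem_Ioc.mp hn).1).ne'
  simp [charAF, toArithmeticFunction, hn0]

/-- The `L(1, χ)`-tail in `charAF` form: `|L(1,χ) − ∑_{n ≤ N} χ(n)/n| ≤ 2A/(N+1)`.
[cite: MontgomeryVaughan2007, §11.2.1 Exercise 3(a)] -/
private theorem norm_LFunction_one_sub_sum_charAF_le {q : ℕ} [NeZero q]
    (χ : DirichletCharacter ℂ q) (hχ : χ ≠ 1) {A : ℝ} (hA : ∀ n, ‖partialSum χ n‖ ≤ A) (N : ℕ) :
    ‖χ.LFunction 1 - ∑ n ∈ Ioc 0 N, charAF χ n / n‖ ≤ 2 * A / ((N : ℝ) + 1) := by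
  have h := norm_sum_div_sub_LFunction_one_le χ hχ hA N
  have heq : ∑ n ∈ Ioc 0 N, charAF χ n / (n : ℂ) =
      ∑ n ∈ Finset.range N, χ ((n + 1 : ℕ) : ZMod q) / ((n : ℂ) + 1) := by
    rw [sum_Ioc_eq_sum_range_succ]
    refine sum_congr rfl fun n _ => ?_
    have hn : (n + 1 : ℕ) ≠ 0 := Nat.succ_ne_zero n
    simp only [charAF, toArithmeticFunction, coe_mk, hn, ↓reduceIte]
    push_cast; ring
  rw [norm_sub_rev, heq]
  exact h

/-- `∑_{n ≤ T} |ζ(n)| = ⌊T⌋ ≤ T`. [folklore] -/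
private theorem sum_norm_zeta_le {T : ℝ} (hT : 1 ≤ T) :
    ∑ n ∈ Ioc 0 ⌊T⌋₊, ‖(ζ : ArithmeticFunction ℂ) n‖ ≤ 1 * T * (1 + Real.log T) ^ 0 := by
  have h1 : ∀ n ∈ Finset.Ioc 0 ⌊T⌋₊, ‖(ζ : ArithmeticFunction ℂ) n‖ = 1 := by
    intro n hn
    have hn0 : n ≠ 0 := ((Finset.mem_Ioc.mp hn).1).ne'
    rw [natCoe_apply, zeta_apply_ne hn0]; simp
  rw [sum_congr rfl h1, sum_const, Nat.card_Ioc, nsmul_eq_mul, mul_one, pow_zero, mul_one, one_mul,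
    Nat.sub_zero]
  exact Nat.floor_le (by linarith)

/-- `∑_{n ≤ T} |(ζ ∗ χ)(n)| ≤ T (1 + log T)`. [folklore] -/
private theorem sum_norm_zetaMul_le {q : ℕ} (χ : DirichletCharacter ℂ q) {T : ℝ} (hT : 1 ≤ T) :
    ∑ n ∈ Ioc 0 ⌊T⌋₊, ‖χ.zetaMul n‖ ≤ 1 * T * (1 + Real.log T) ^ (0 + 1) := by
  have h : χ.zetaMul = charAF χ * (ζ : ArithmeticFunction ℂ) := by
    rw [DirichletCharacter.zetaMul, mul_comm]
  rw [h]
  exact sum_norm_mul_le _ _ (norm_charAF_le_one χ) (fun T hT => sum_norm_zeta_le hT) hT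

/-- `∑_{n ≤ T} |(ζ ∗ χ₁ ∗ χ₂)(n)| ≤ T (1 + log T)²`. [folklore] -/
private theorem sum_norm_charAF_mul_zetaMul_le {q₁ q₂ : ℕ} (χ₁ : DirichletCharacter ℂ q₁)
    (χ₂ : DirichletCharacter ℂ q₂) {T : ℝ} (hT : 1 ≤ T) :
    ∑ n ∈ Ioc 0 ⌊T⌋₊, ‖(charAF χ₂ * χ₁.zetaMul) n‖ ≤ 1 * T * (1 + Real.log T) ^ (0 + 1 + 1) :=
  sum_norm_mul_le _ _ (norm_charAF_le_one χ₂) (fun _ hT => sum_norm_zetaMul_le χ₁ hT) hT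

/-- **Lemma 1 for `j = 1`** (complex form of Part C of `RealZerosPintzContinuation`):
`|∑_{n ≤ y} (ζ ∗ χ)(n) − L(1,χ) y| ≤ 5√A y^{1/2}` for `y ≥ A`, `χ` quadratic with partial sums
`≤ A`. [cite: Pintz1977ElementaryVIII, Lemma 1 (3.9) p. 92] -/
theorem norm_summatory_zetaMul_sub_le {q : ℕ} [NeZero q] (χ : DirichletCharacter ℂ q)
    (hχ : χ ≠ 1) (hq : χ ^ 2 = 1) {A : ℝ} (hA1 : 1 ≤ A) (hA : ∀ n, ‖partialSum χ n‖ ≤ A)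
    {y : ℝ} (hy : A ≤ y) :
    ‖∑ n ∈ Ioc 0 ⌊y⌋₊, χ.zetaMul n - χ.LFunction 1 * y‖ ≤
      5 * Real.sqrt A * y ^ (1 / 2 : ℝ) * (1 + Real.log y) ^ 0 := by
  have h := abs_sum_charDivisorSum_sub_le_of_partialSum_le χ hχ hA1 hA hy
  have hA0 : 0 ≤ A := by linarith
  have hL : χ.LFunction 1 = (((χ.LFunction 1).re : ℝ) : ℂ) := by
    have := LFunction_ofReal_eq_re χ hχ hq one_pos
    rwa [ofReal_one] at this
  have hcast : ∑ n ∈ Ioc 0 ⌊y⌋₊, χ.zetaMul n - χ.LFunction 1 * y =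
      ((∑ n ∈ Ioc 0 ⌊y⌋₊, charDivisorSum χ n - (χ.LFunction 1).re * y : ℝ) : ℂ) := by
    conv_lhs => rw [hL]
    push_cast
    simp only [← ofReal_charDivisorSum χ hq]
  rw [hcast, Complex.norm_real, Real.norm_eq_abs, pow_zero, mul_one, ← Real.sqrt_eq_rpow,
    mul_assoc, ← Real.sqrt_mul hA0]
  exact h

variable {D₁ D₂ : ℕ} [NeZero D₁] [NeZero D₂] (χ₁ : DirichletCharacter ℂ D₁)
  (χ₂ : DirichletCharacter ℂ D₂)

set_option maxHeartbeats 400000 in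
/-- **Lemma 1 for `j = 2`**: with partial-sum bounds `A₁, A₂ ≥ 1` for the quadratic characters
`χ₁, χ₂` and `|L(1,χ₁)| ≤ ℓ`, for `y ≥ A₁A₂`,
`|∑_{n ≤ y} (ζ ∗ χ₁ ∗ χ₂)(n) − L(1,χ₁)L(1,χ₂) y| ≤ 16 ℓ (A₁A₂)^{1/3} y^{2/3} (1 + log y)`
(the printed `y{L₁L₂ + O(log y ((A₁A₂)/y)^{1/3})}` with `z = (y A₂²/A₁)^{1/3}`).
[cite: Pintz1977ElementaryVIII, Lemma 1 (3.3), (3.10) pp. 91–93] -/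
theorem norm_summatory_two_sub_le (hχ₁ : χ₁ ≠ 1) (hq₁ : χ₁ ^ 2 = 1) (hχ₂ : χ₂ ≠ 1)
    {A₁ A₂ ℓ : ℝ} (hA₁1 : 1 ≤ A₁) (hA₂1 : 1 ≤ A₂) (hℓ1 : 1 ≤ ℓ)
    (hA₁ : ∀ n, ‖partialSum χ₁ n‖ ≤ A₁) (hA₂ : ∀ n, ‖partialSum χ₂ n‖ ≤ A₂)
    (hL₁ : ‖χ₁.LFunction 1‖ ≤ ℓ) {y : ℝ} (hy : A₁ * A₂ ≤ y) :
    ‖∑ n ∈ Ioc 0 ⌊y⌋₊, (charAF χ₂ * χ₁.zetaMul) n - χ₁.LFunction 1 * χ₂.LFunction 1 * y‖ ≤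
      16 * ℓ * (A₁ * A₂) ^ (1 / 3 : ℝ) * y ^ (2 / 3 : ℝ) * (1 + Real.log y) ^ 1 := by
  have hA₁0 : 0 < A₁ := by linarith
  have hA₂0 : 0 < A₂ := by linarith
  have hP1 : 1 ≤ A₁ * A₂ := by nlinarith
  have hy1 : 1 ≤ y := hP1.trans hy
  have hy0 : 0 < y := by linarith
  have hlogy : 0 ≤ Real.log y := Real.log_nonneg hy1
  -- `K = (A₁A₂y²)^{1/3}`
  set K : ℝ := (A₁ * A₂ * y ^ 2) ^ (1 / 3 : ℝ) with hK
  have hX0 : 0 < A₁ * A₂ * y ^ 2 := by positivity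
  have hK0 : 0 < K := Real.rpow_pos_of_pos hX0 _
  have hK3 : K ^ 3 = A₁ * A₂ * y ^ 2 := by
    rw [hK, ← Real.rpow_natCast, ← Real.rpow_mul hX0.le]; norm_num
  -- `w = A₂ y / K` (so that `A₂ y / w = K`), `z = ⌊w⌋`
  set w : ℝ := A₂ * y / K with hw
  have hw0 : 0 < w := by positivity
  have hwK : A₂ * y / w = K := by rw [hw]; field_simp
  have hw1 : 1 ≤ w := by
    rw [hw, le_div_iff₀ hK0, one_mul]
    have h3 : K ^ 3 ≤ (A₂ * y) ^ 3 := by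
      rw [hK3]
      have h1 : A₁ ≤ A₂ ^ 2 * y := by
        have e1 : A₁ ≤ y := le_trans (le_mul_of_one_le_right hA₁0.le hA₂1) hy
        have e2 : y ≤ A₂ ^ 2 * y := le_mul_of_one_le_left hy0.le (one_le_pow₀ hA₂1)
        linarith
      have h2 : 0 ≤ A₂ * y ^ 2 := by positivity
      nlinarith
    exact (pow_le_pow_iff_left₀ hK0.le (by positivity) (by norm_num)).mp h3
  have hPK : A₁ * A₂ ≤ K := by
    have h3 : (A₁ * A₂) ^ 3 ≤ K ^ 3 := by
      rw [hK3]
      have : (A₁ * A₂) ^ 2 ≤ y ^ 2 := pow_le_pow_left₀ (by positivity) hy 2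
      nlinarith
    exact (pow_le_pow_iff_left₀ (by positivity) hK0.le (by norm_num)).mp h3
  have hwA : w * A₁ ≤ y := by
    rw [hw, div_mul_eq_mul_div, div_le_iff₀ hK0]
    nlinarith
  set z : ℕ := ⌊w⌋₊ with hz
  have hz1 : 1 ≤ z := Nat.le_floor (by simpa using hw1)
  have hzw : (z : ℝ) ≤ w := Nat.floor_le hw0.le
  have hwz : w < z + 1 := Nat.lt_floor_add_one w
  have hz0 : (0 : ℝ) < z := by exact_mod_cast hz1
  have hz1r : (1 : ℝ) ≤ z := by exact_mod_cast hz1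
  have hzy : (z : ℝ) * A₁ ≤ y := le_trans (mul_le_mul_of_nonneg_right hzw hA₁0.le) hwA
  -- the hyperbola step
  have hstep := norm_summatory_mul_sub_le (charAF χ₂) χ₁.zetaMul (A := A₂)
    (Bg := 5 * Real.sqrt A₁) (β := 1 / 2) (Y₀ := A₁) (k := 0) (b := χ₁.LFunction 1)
    (L := χ₂.LFunction 1) (norm_charAF_le_one χ₂)
    (fun N => by rw [sum_Ioc_charAF_eq]; exact hA₂ N)
    (norm_LFunction_one_sub_sum_charAF_le χ₂ hχ₂ hA₂) hA₁1 (by norm_num) (by norm_num)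
    (fun y' hy' => norm_summatory_zetaMul_sub_le χ₁ hχ₁ hq₁ hA₁1 hA₁ hy') hz1 hzy
  -- the three terms
  have hT1 : 2 * A₂ * ‖χ₁.LFunction 1‖ * y / ((z : ℝ) + 1) ≤ 2 * ℓ * K := by
    calc 2 * A₂ * ‖χ₁.LFunction 1‖ * y / ((z : ℝ) + 1) ≤ 2 * A₂ * ℓ * y / ((z : ℝ) + 1) := by
          gcongr
      _ ≤ 2 * A₂ * ℓ * y / w := by gcongr
      _ = 2 * ℓ * (A₂ * y / w) := by ring
      _ = 2 * ℓ * K := by rw [hwK]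
  have hT2 : 5 * Real.sqrt A₁ * y ^ (1 / 2 : ℝ) * (1 + Real.log y) ^ 0 *
      ((z : ℝ) ^ (1 - 1 / 2 : ℝ) / (1 - 1 / 2)) ≤ 10 * K := by
    have hsq : Real.sqrt A₁ * y ^ (1 / 2 : ℝ) * (z : ℝ) ^ (1 - 1 / 2 : ℝ) =
        Real.sqrt (A₁ * y * z) := by
      rw [show (1 : ℝ) - 1 / 2 = 1 / 2 by norm_num, ← Real.sqrt_eq_rpow, ← Real.sqrt_eq_rpow,
        ← Real.sqrt_mul hA₁0.le, ← Real.sqrt_mul (by positivity)]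
    have hle : A₁ * y * z ≤ K ^ 2 := by
      have hAyw : A₁ * y * w = K ^ 2 := by
        rw [hw]; field_simp; nlinarith [hK3]
      calc A₁ * y * z ≤ A₁ * y * w := by gcongr
        _ = K ^ 2 := hAyw
    have hsqrt : Real.sqrt (A₁ * y * z) ≤ K := by
      rw [← Real.sqrt_sq hK0.le]; exact Real.sqrt_le_sqrt hle
    calc 5 * Real.sqrt A₁ * y ^ (1 / 2 : ℝ) * (1 + Real.log y) ^ 0 *
        ((z : ℝ) ^ (1 - 1 / 2 : ℝ) / (1 - 1 / 2))
        = 10 * (Real.sqrt A₁ * y ^ (1 / 2 : ℝ) * (z : ℝ) ^ (1 - 1 / 2 : ℝ)) := by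
          rw [pow_zero]; ring
      _ ≤ 10 * K := by rw [hsq]; gcongr
  have hT3 : 2 * A₂ * ∑ n ∈ Ioc 0 ⌊y / z⌋₊, ‖χ₁.zetaMul n‖ ≤ 4 * K * (1 + Real.log y) := by
    have hyz1 : 1 ≤ y / z := by
      rw [le_div_iff₀ hz0]; nlinarith
    have hM := sum_norm_zetaMul_le χ₁ hyz1
    have hlog : Real.log (y / z) ≤ Real.log y := by
      rw [Real.log_div hy0.ne' hz0.ne']; linarith [Real.log_nonneg hz1r]
    have hyz : y / z ≤ 2 * y / w := by
      rw [div_le_div_iff₀ hz0 hw0]; nlinarith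
    have hyz0 : 0 ≤ y / z := by positivity
    calc 2 * A₂ * ∑ n ∈ Ioc 0 ⌊y / z⌋₊, ‖χ₁.zetaMul n‖
        ≤ 2 * A₂ * ((y / z) * (1 + Real.log y)) := by
          refine mul_le_mul_of_nonneg_left ?_ (by positivity)
          calc ∑ n ∈ Ioc 0 ⌊y / z⌋₊, ‖χ₁.zetaMul n‖
              ≤ 1 * (y / z) * (1 + Real.log (y / z)) ^ (0 + 1) := hM
            _ ≤ (y / z) * (1 + Real.log y) := by
                rw [one_mul, zero_add, pow_one]; gcongr
      _ ≤ 2 * A₂ * ((2 * y / w) * (1 + Real.log y)) := by gcongr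
      _ = 4 * (A₂ * y / w) * (1 + Real.log y) := by ring
      _ = 4 * K * (1 + Real.log y) := by rw [hwK]
  -- assemble
  have hKeq : K = (A₁ * A₂) ^ (1 / 3 : ℝ) * y ^ (2 / 3 : ℝ) := by
    rw [hK, Real.mul_rpow (by positivity) (by positivity),
      show (2 / 3 : ℝ) = 2 * (1 / 3) by norm_num, Real.rpow_mul hy0.le,
      show ((y ^ (2 : ℝ)) : ℝ) = y ^ (2 : ℕ) by rw [← Real.rpow_natCast]; norm_num]
  have hu1 : 1 ≤ 1 + Real.log y := by linarith
  have hfin : 2 * ℓ * K + 10 * K + 4 * K * (1 + Real.log y) ≤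
      16 * ℓ * K * (1 + Real.log y) := by
    have h1 : 2 * ℓ * K ≤ 2 * ℓ * K * (1 + Real.log y) :=
      le_mul_of_one_le_right (by positivity) hu1
    have h2 : 10 * K ≤ 10 * ℓ * K * (1 + Real.log y) := by
      have : 10 * K * 1 * 1 ≤ 10 * K * ℓ * (1 + Real.log y) := by gcongr
      linarith
    have h3 : 4 * K * (1 + Real.log y) ≤ 4 * ℓ * K * (1 + Real.log y) := by
      have : 4 * K * (1 + Real.log y) * 1 ≤ 4 * K * (1 + Real.log y) * ℓ := by gcongr
      linarith
    linarith
  calc _ ≤ _ := hstep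
    _ ≤ 2 * ℓ * K + 10 * K + 4 * K * (1 + Real.log y) := by linarith [hT1, hT2, hT3]
    _ ≤ 16 * ℓ * K * (1 + Real.log y) := hfin
    _ = 16 * ℓ * (A₁ * A₂) ^ (1 / 3 : ℝ) * y ^ (2 / 3 : ℝ) * (1 + Real.log y) ^ 1 := by
        rw [hKeq, pow_one]; ring

set_option maxHeartbeats 400000 in
/-- **Lemma 1 for `j = 3`**: with partial-sum bounds `A₁, A₂, A₃ ≥ 1` for `χ₁, χ₂` (quadratic)
and a third non-principal character `ψ`, and `|L(1,χ₁)|, |L(1,χ₂)| ≤ ℓ`, for `y ≥ A = A₁A₂A₃`,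
`|∑_{n ≤ y} (ζ ∗ χ₁ ∗ χ₂ ∗ ψ)(n) − L(1,χ₁)L(1,χ₂)L(1,ψ) y| ≤ 54 ℓ² A^{1/4} y^{3/4} (1 + log y)²`
(the printed (3.3) for `j = 3`: `y{∏ L_i(1) + O((A/y)^{1/4} log² y)}`, `z = (y A₃³/(A₁A₂))^{1/4}`).
[cite: Pintz1977ElementaryVIII, Lemma 1 (3.3), (3.10) pp. 91–93] -/
theorem norm_summatory_three_sub_le (hχ₁ : χ₁ ≠ 1) (hq₁ : χ₁ ^ 2 = 1) (hχ₂ : χ₂ ≠ 1)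
    {q₃ : ℕ} [NeZero q₃] (ψ : DirichletCharacter ℂ q₃) (hψ : ψ ≠ 1)
    {A₁ A₂ A₃ ℓ : ℝ} (hA₁1 : 1 ≤ A₁) (hA₂1 : 1 ≤ A₂) (hA₃1 : 1 ≤ A₃) (hℓ1 : 1 ≤ ℓ)
    (hA₁ : ∀ n, ‖partialSum χ₁ n‖ ≤ A₁) (hA₂ : ∀ n, ‖partialSum χ₂ n‖ ≤ A₂)
    (hA₃ : ∀ n, ‖partialSum ψ n‖ ≤ A₃)
    (hL₁ : ‖χ₁.LFunction 1‖ ≤ ℓ) (hL₂ : ‖χ₂.LFunction 1‖ ≤ ℓ) {y : ℝ} (hy : A₁ * A₂ * A₃ ≤ y) :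
    ‖∑ n ∈ Ioc 0 ⌊y⌋₊, (charAF ψ * (charAF χ₂ * χ₁.zetaMul)) n
        - χ₁.LFunction 1 * χ₂.LFunction 1 * ψ.LFunction 1 * y‖ ≤
      54 * ℓ ^ 2 * (A₁ * A₂ * A₃) ^ (1 / 4 : ℝ) * y ^ (3 / 4 : ℝ) * (1 + Real.log y) ^ 2 := by
  have hA₁0 : 0 < A₁ := by linarith
  have hA₂0 : 0 < A₂ := by linarith
  have hA₃0 : 0 < A₃ := by linarith
  have hP1 : 1 ≤ A₁ * A₂ := by nlinarith
  have hP0 : 0 < A₁ * A₂ := by positivity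
  have hPA : A₁ * A₂ ≤ A₁ * A₂ * A₃ := le_mul_of_one_le_right hP0.le hA₃1
  have hyP : A₁ * A₂ ≤ y := hPA.trans hy
  have hy1 : 1 ≤ y := hP1.trans hyP
  have hy0 : 0 < y := by linarith
  have hlogy : 0 ≤ Real.log y := Real.log_nonneg hy1
  set A : ℝ := A₁ * A₂ * A₃ with hAdef
  have hA0 : 0 < A := by positivity
  -- `K = (A y³)^{1/4}`
  set K : ℝ := (A * y ^ 3) ^ (1 / 4 : ℝ) with hK
  have hX0 : 0 < A * y ^ 3 := by positivity
  have hK0 : 0 < K := Real.rpow_pos_of_pos hX0 _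
  have hK4 : K ^ 4 = A * y ^ 3 := by
    rw [hK, ← Real.rpow_natCast, ← Real.rpow_mul hX0.le]; norm_num
  -- `w = A₃ y / K`, `z = ⌊w⌋`
  set w : ℝ := A₃ * y / K with hw
  have hw0 : 0 < w := by positivity
  have hwK : A₃ * y / w = K := by rw [hw]; field_simp
  have hw1 : 1 ≤ w := by
    rw [hw, le_div_iff₀ hK0, one_mul]
    have h4 : K ^ 4 ≤ (A₃ * y) ^ 4 := by
      rw [hK4, hAdef]
      have h1 : A₁ * A₂ ≤ A₃ ^ 3 * y := by
        have e2 : y ≤ A₃ ^ 3 * y := le_mul_of_one_le_left hy0.le (one_le_pow₀ hA₃1)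
        linarith
      have h2 : 0 ≤ A₃ * y ^ 3 := by positivity
      nlinarith
    exact (pow_le_pow_iff_left₀ hK0.le (by positivity) (by norm_num)).mp h4
  have hAK : A ≤ K := by
    have h4 : A ^ 4 ≤ K ^ 4 := by
      rw [hK4]
      have : A ^ 3 ≤ y ^ 3 := pow_le_pow_left₀ hA0.le hy 3
      nlinarith
    exact (pow_le_pow_iff_left₀ hA0.le hK0.le (by norm_num)).mp h4
  have hwP : w * (A₁ * A₂) ≤ y := by
    rw [hw, div_mul_eq_mul_div, div_le_iff₀ hK0]
    have : A₃ * y * (A₁ * A₂) = A * y := by rw [hAdef]; ring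
    rw [this]
    nlinarith
  set z : ℕ := ⌊w⌋₊ with hz
  have hz1 : 1 ≤ z := Nat.le_floor (by simpa using hw1)
  have hzw : (z : ℝ) ≤ w := Nat.floor_le hw0.le
  have hwz : w < z + 1 := Nat.lt_floor_add_one w
  have hz0 : (0 : ℝ) < z := by exact_mod_cast hz1
  have hz1r : (1 : ℝ) ≤ z := by exact_mod_cast hz1
  have hzy : (z : ℝ) * (A₁ * A₂) ≤ y := le_trans (mul_le_mul_of_nonneg_right hzw hP0.le) hwP
  -- the three terms
  have hb : ‖χ₁.LFunction 1 * χ₂.LFunction 1‖ ≤ ℓ ^ 2 := by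
    rw [norm_mul, sq]
    exact mul_le_mul hL₁ hL₂ (norm_nonneg _) (by linarith)
  have hT1 : 2 * A₃ * ‖χ₁.LFunction 1 * χ₂.LFunction 1‖ * y / ((z : ℝ) + 1) ≤ 2 * ℓ ^ 2 * K := by
    calc 2 * A₃ * ‖χ₁.LFunction 1 * χ₂.LFunction 1‖ * y / ((z : ℝ) + 1)
        ≤ 2 * A₃ * ℓ ^ 2 * y / ((z : ℝ) + 1) := by gcongr
      _ ≤ 2 * A₃ * ℓ ^ 2 * y / w := by gcongr
      _ = 2 * ℓ ^ 2 * (A₃ * y / w) := by ring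
      _ = 2 * ℓ ^ 2 * K := by rw [hwK]
  have hT2 : 16 * ℓ * (A₁ * A₂) ^ (1 / 3 : ℝ) * y ^ (2 / 3 : ℝ) * (1 + Real.log y) ^ 1 *
      ((z : ℝ) ^ (1 - 2 / 3 : ℝ) / (1 - 2 / 3)) ≤ 48 * ℓ * K * (1 + Real.log y) := by
    -- `J = (A₁A₂)^{1/3} y^{2/3} z^{1/3}` has `J³ = A₁A₂ y² z ≤ A₁A₂ y² w = K³`
    set J : ℝ := (A₁ * A₂) ^ (1 / 3 : ℝ) * y ^ (2 / 3 : ℝ) * (z : ℝ) ^ (1 / 3 : ℝ) with hJ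
    have hJ0 : 0 ≤ J := by positivity
    have hJ3 : J ^ 3 = A₁ * A₂ * y ^ 2 * z := by
      rw [hJ, mul_pow, mul_pow, ← Real.rpow_natCast ((A₁ * A₂) ^ (1 / 3 : ℝ)),
        ← Real.rpow_mul hP0.le, ← Real.rpow_natCast (y ^ (2 / 3 : ℝ)), ← Real.rpow_mul hy0.le,
        ← Real.rpow_natCast ((z : ℝ) ^ (1 / 3 : ℝ)), ← Real.rpow_mul hz0.le]
      norm_num
    have hK3 : A₁ * A₂ * y ^ 2 * w = K ^ 3 := by
      have h1 : A₁ * A₂ * y ^ 2 * w * K = K ^ 4 := by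
        rw [hK4, hw, hAdef]; field_simp
      have h2 : K ^ 4 = K ^ 3 * K := by ring
      rw [h2] at h1
      exact mul_right_cancel₀ hK0.ne' h1
    have hJK : J ≤ K := by
      have h3 : J ^ 3 ≤ K ^ 3 := by
        rw [hJ3, ← hK3]; gcongr
      exact (pow_le_pow_iff_left₀ hJ0 hK0.le (by norm_num)).mp h3
    calc 16 * ℓ * (A₁ * A₂) ^ (1 / 3 : ℝ) * y ^ (2 / 3 : ℝ) * (1 + Real.log y) ^ 1 *
        ((z : ℝ) ^ (1 - 2 / 3 : ℝ) / (1 - 2 / 3))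
        = 48 * ℓ * J * (1 + Real.log y) := by
          rw [hJ, pow_one, show (1 : ℝ) - 2 / 3 = 1 / 3 by norm_num]; ring
      _ ≤ 48 * ℓ * K * (1 + Real.log y) := by gcongr
  have hT3 : 2 * A₃ * ∑ n ∈ Ioc 0 ⌊y / z⌋₊, ‖(charAF χ₂ * χ₁.zetaMul) n‖ ≤
      4 * K * (1 + Real.log y) ^ 2 := by
    have hyz1 : 1 ≤ y / z := by
      rw [le_div_iff₀ hz0]; nlinarith
    have hM := sum_norm_charAF_mul_zetaMul_le χ₁ χ₂ hyz1
    have hlog : Real.log (y / z) ≤ Real.log y := by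
      rw [Real.log_div hy0.ne' hz0.ne']; linarith [Real.log_nonneg hz1r]
    have hlog0 : 0 ≤ 1 + Real.log (y / z) := by linarith [Real.log_nonneg hyz1]
    have hyz : y / z ≤ 2 * y / w := by
      rw [div_le_div_iff₀ hz0 hw0]; nlinarith
    have hyz0 : 0 ≤ y / z := by positivity
    calc 2 * A₃ * ∑ n ∈ Ioc 0 ⌊y / z⌋₊, ‖(charAF χ₂ * χ₁.zetaMul) n‖
        ≤ 2 * A₃ * ((y / z) * (1 + Real.log y) ^ 2) := by
          refine mul_le_mul_of_nonneg_left ?_ (by positivity)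
          calc ∑ n ∈ Ioc 0 ⌊y / z⌋₊, ‖(charAF χ₂ * χ₁.zetaMul) n‖
              ≤ 1 * (y / z) * (1 + Real.log (y / z)) ^ (0 + 1 + 1) := hM
            _ ≤ (y / z) * (1 + Real.log y) ^ 2 := by
                rw [one_mul, show 0 + 1 + 1 = 2 from rfl]
                refine mul_le_mul_of_nonneg_left ?_ hyz0
                exact pow_le_pow_left₀ hlog0 (by linarith) 2
      _ ≤ 2 * A₃ * ((2 * y / w) * (1 + Real.log y) ^ 2) := by gcongr
      _ = 4 * (A₃ * y / w) * (1 + Real.log y) ^ 2 := by ring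
      _ = 4 * K * (1 + Real.log y) ^ 2 := by rw [hwK]
  -- assemble
  have hKeq : K = A ^ (1 / 4 : ℝ) * y ^ (3 / 4 : ℝ) := by
    rw [hK, Real.mul_rpow hA0.le (by positivity),
      show (3 / 4 : ℝ) = 3 * (1 / 4) by norm_num, Real.rpow_mul hy0.le,
      show ((y ^ (3 : ℝ)) : ℝ) = y ^ (3 : ℕ) by rw [← Real.rpow_natCast]; norm_num]
  have hu1 : 1 ≤ 1 + Real.log y := by linarith
  set u := 1 + Real.log y with hu
  have hfin : 2 * ℓ ^ 2 * K + 48 * ℓ * K * u + 4 * K * u ^ 2 ≤ 54 * ℓ ^ 2 * K * u ^ 2 := by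
    have hℓ2 : 1 ≤ ℓ ^ 2 := one_le_pow₀ hℓ1
    have hu2 : 1 ≤ u ^ 2 := one_le_pow₀ hu1
    have hℓℓ : ℓ ≤ ℓ ^ 2 := by
      calc ℓ = ℓ * 1 := (mul_one ℓ).symm
        _ ≤ ℓ * ℓ := mul_le_mul_of_nonneg_left hℓ1 (by linarith)
        _ = ℓ ^ 2 := (sq ℓ).symm
    have huu : u ≤ u ^ 2 := by
      calc u = u * 1 := (mul_one u).symm
        _ ≤ u * u := mul_le_mul_of_nonneg_left hu1 (by linarith)
        _ = u ^ 2 := (sq u).symm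
    have hlu : ℓ * u ≤ ℓ ^ 2 * u ^ 2 := mul_le_mul hℓℓ huu (by linarith) (by positivity)
    have h1 : 2 * ℓ ^ 2 * K ≤ 2 * ℓ ^ 2 * K * u ^ 2 :=
      le_mul_of_one_le_right (by positivity) hu2
    have h2 : 48 * ℓ * K * u ≤ 48 * ℓ ^ 2 * K * u ^ 2 := by
      calc 48 * ℓ * K * u = 48 * K * (ℓ * u) := by ring
        _ ≤ 48 * K * (ℓ ^ 2 * u ^ 2) := mul_le_mul_of_nonneg_left hlu (by positivity)
        _ = 48 * ℓ ^ 2 * K * u ^ 2 := by ring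
    have h3 : 4 * K * u ^ 2 ≤ 4 * ℓ ^ 2 * K * u ^ 2 := by
      calc 4 * K * u ^ 2 = 4 * K * u ^ 2 * 1 := by ring
        _ ≤ 4 * K * u ^ 2 * ℓ ^ 2 := mul_le_mul_of_nonneg_left hℓ2 (by positivity)
        _ = 4 * ℓ ^ 2 * K * u ^ 2 := by ring
    linarith
  have hRHS : 54 * ℓ ^ 2 * K * u ^ 2 = 54 * ℓ ^ 2 * A ^ (1 / 4 : ℝ) * y ^ (3 / 4 : ℝ) * u ^ 2 := by
    rw [hKeq]; ring
  rw [← hRHS]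
  -- the hyperbola step, on top of Lemma 1 for `j = 2`
  have hstep := norm_summatory_mul_sub_le (charAF ψ) (charAF χ₂ * χ₁.zetaMul) (A := A₃)
    (Bg := 16 * ℓ * (A₁ * A₂) ^ (1 / 3 : ℝ)) (β := 2 / 3) (Y₀ := A₁ * A₂) (k := 1)
    (b := χ₁.LFunction 1 * χ₂.LFunction 1) (L := ψ.LFunction 1) (norm_charAF_le_one ψ)
    (fun N => by rw [sum_Ioc_charAF_eq]; exact hA₃ N)
    (norm_LFunction_one_sub_sum_charAF_le ψ hψ hA₃) hP1 (by norm_num) (by norm_num)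
    (fun y' hy' => norm_summatory_two_sub_le χ₁ χ₂ hχ₁ hq₁ hχ₂ hA₁1 hA₂1 hℓ1 hA₁ hA₂ hL₁ hy')
    hz1 hzy
  exact hstep.trans ((add_le_add (add_le_add hT1 hT2) hT3).trans hfin)

omit [NeZero D₁] [NeZero D₂] in
/-- The coefficient sequence of `ζ(s)L(s,χ₁)L(s,χ₂)L(s,χ₁χ₂)` (the tree's
`SiegelCoefficients.coeff`, Montgomery–Vaughan p. 285) is `χ₁χ₂ ∗ (χ₂ ∗ (ζ ∗ χ₁))`. [folklore] -/
private theorem coeff_eq_charAF_mul :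
    coeff χ₁ χ₂ = charAF (prodChar χ₁ χ₂) * (charAF χ₂ * χ₁.zetaMul) := by
  have h : prodAF χ₁ χ₂ = charAF (prodChar χ₁ χ₂) := by
    ext n
    rcases eq_or_ne n 0 with rfl | hn
    · simp [charAF]
    · rw [prodAF_apply χ₁ χ₂ hn]
      simp [charAF, toArithmeticFunction, hn, prodChar_apply_natCast]
  rw [coeff, h]; ring

/-- **Lemma 1 (`j = 3`) for `F(s, χ₁, χ₂) = ζ(s)L(s,χ₁)L(s,χ₂)L(s,χ₁χ₂)`**: with partial-sum bounds
`A₁, A₂, A₃ ≥ 1` for `χ₁`, `χ₂`, `χ₁χ₂ (mod D₁D₂)` (all non-principal, `χ₁, χ₂` quadratic),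
`|L(1,χ_i)| ≤ ℓ`, and `y ≥ A = A₁A₂A₃`:
`|∑_{n ≤ y} r(n) − L(1,χ₁)L(1,χ₂)L(1,χ₁χ₂) y| ≤ 54 ℓ² A^{1/4} y^{3/4} (1 + log y)²`, where
`r(n) ≥ 0` are the Dirichlet coefficients of `F(s, χ₁, χ₂)`. [cite: Pintz1977ElementaryVIII, Lemma 1 (3.3) p. 91; §4 p. 95 (`F₃`)] -/
theorem norm_summatory_coeff_sub_le (hχ₁ : χ₁ ≠ 1) (hq₁ : χ₁ ^ 2 = 1) (hχ₂ : χ₂ ≠ 1)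
    (hψ : prodChar χ₁ χ₂ ≠ 1) {A₁ A₂ A₃ ℓ : ℝ} (hA₁1 : 1 ≤ A₁) (hA₂1 : 1 ≤ A₂) (hA₃1 : 1 ≤ A₃)
    (hℓ1 : 1 ≤ ℓ) (hA₁ : ∀ n, ‖partialSum χ₁ n‖ ≤ A₁) (hA₂ : ∀ n, ‖partialSum χ₂ n‖ ≤ A₂)
    (hA₃ : ∀ n, ‖partialSum (prodChar χ₁ χ₂) n‖ ≤ A₃)
    (hL₁ : ‖χ₁.LFunction 1‖ ≤ ℓ) (hL₂ : ‖χ₂.LFunction 1‖ ≤ ℓ) {y : ℝ} (hy : A₁ * A₂ * A₃ ≤ y) :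
    ‖∑ n ∈ Ioc 0 ⌊y⌋₊, coeff χ₁ χ₂ n
        - χ₁.LFunction 1 * χ₂.LFunction 1 * (prodChar χ₁ χ₂).LFunction 1 * y‖ ≤
      54 * ℓ ^ 2 * (A₁ * A₂ * A₃) ^ (1 / 4 : ℝ) * y ^ (3 / 4 : ℝ) * (1 + Real.log y) ^ 2 := by
  rw [coeff_eq_charAF_mul]
  exact norm_summatory_three_sub_le χ₁ χ₂ hχ₁ hq₁ hχ₂ (prodChar χ₁ χ₂) hψ hA₁1 hA₂1 hA₃1 hℓ1
    hA₁ hA₂ hA₃ hL₁ hL₂ hy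

end LemmaOne

/-! ## Part C. `F(s) = F(s, χ₁, χ₂) = ζ(s)L(s,χ₁)L(s,χ₂)L(s,χ₁χ₂)`: the §4 engine on the window
`[1 − 1/log N, 1)` (proof of Theorems 4–5, p. 96) -/

section LandauWindow

open DirichletAbel RealChar SiegelCoefficients
open scoped ComplexOrder

variable {D₁ D₂ : ℕ} [NeZero D₁] [NeZero D₂] (χ₁ : DirichletCharacter ℂ D₁)
  (χ₂ : DirichletCharacter ℂ D₂)

omit [NeZero D₁] [NeZero D₂] in
/-- The coefficients `r(n)` are real: `r(n) = Re r(n)` (from `r(n) ≥ 0` in `ℂ`). [folklore] -/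
private theorem ofReal_re_coeff (h₁ : χ₁ ^ 2 = 1) (h₂ : χ₂ ^ 2 = 1) (n : ℕ) :
    (((coeff χ₁ χ₂ n).re : ℝ) : ℂ) = coeff χ₁ χ₂ n := by
  have h := Complex.nonneg_iff.mp (coeff_nonneg χ₁ χ₂ h₁ h₂ n)
  exact Complex.ext (by simp) (by simp [← h.2])

omit [NeZero D₁] [NeZero D₂] in
/-- **`r(4) ≥ 1`** for `r = ζ ∗ χ₁ ∗ χ₂ ∗ χ₁χ₂`, `χ₁, χ₂` quadratic (Pintz p. 96: "`f(4) ≥ 1`"):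
with `ε_i = χ_i(2) ∈ {0, ±1}`, `r(4) = ε₂² r₁(4) + ε₂ r₁(2)² + r₁(4)`, `r₁(2) = 1 + ε₁`,
`r₁(4) = 1 + ε₁ + ε₁²`. [cite: Pintz1977ElementaryVIII, §4 p. 96] -/
theorem one_le_re_coeff_four (h₁ : χ₁ ^ 2 = 1) (h₂ : χ₂ ^ 2 = 1) :
    1 ≤ (coeff χ₁ χ₂ 4).re := by
  have hq₁ := MulChar.isQuadratic_iff_sq_eq_one.mpr h₁ ((2 : ℕ) : ZMod D₁)
  have hq₂ := MulChar.isQuadratic_iff_sq_eq_one.mpr h₂ ((2 : ℕ) : ZMod D₂)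
  have hdiv : Nat.divisors 4 = {1, 2, 4} := by decide
  have hz1 : χ₁.zetaMul 1 = 1 := (χ₁.isMultiplicative_zetaMul).map_one
  have hz2 : χ₁.zetaMul 2 = 1 + χ₁ ((2 : ℕ) : ZMod D₁) := by
    have := zetaMul_prime_pow χ₁ Nat.prime_two 1
    rw [pow_one] at this
    rw [this, Finset.sum_range_succ, Finset.sum_range_succ, Finset.sum_range_zero]
    simp
  have hz4 : χ₁.zetaMul 4 = 1 + χ₁ ((2 : ℕ) : ZMod D₁) + χ₁ ((2 : ℕ) : ZMod D₁) ^ 2 := by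
    have := zetaMul_prime_pow χ₁ Nat.prime_two 2
    rw [show (2 : ℕ) ^ 2 = 4 by norm_num] at this
    rw [this, Finset.sum_range_succ, Finset.sum_range_succ, Finset.sum_range_succ,
      Finset.sum_range_zero]
    simp
  have hχ₂4 : χ₂ ((4 : ℕ) : ZMod D₂) = χ₂ ((2 : ℕ) : ZMod D₂) ^ 2 := by
    rw [show (4 : ℕ) = 2 ^ 2 by norm_num, Nat.cast_pow, map_pow]
  have hχ₂1 : χ₂ ((1 : ℕ) : ZMod D₂) = 1 := by simp
  have hval : coeff χ₁ χ₂ 4 = χ₂ ((2 : ℕ) : ZMod D₂) ^ 2 * χ₁.zetaMul 4 +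
      χ₂ ((2 : ℕ) : ZMod D₂) * χ₁.zetaMul 2 ^ 2 + χ₁.zetaMul 4 := by
    rw [coeff, charAF_mul_prodAF, mul_apply, Nat.sum_divisorsAntidiagonal
      (fun i j => χ₁.zetaMul i * ((charAF χ₂).pmul χ₁.zetaMul) j), hdiv]
    rw [Finset.sum_insert (by decide), Finset.sum_insert (by decide), Finset.sum_singleton]
    simp only [show (4 : ℕ) / 1 = 4 from rfl, show (4 : ℕ) / 2 = 2 from rfl,
      show (4 : ℕ) / 4 = 1 from rfl, pmul_apply, hz1]
    simp only [charAF, toArithmeticFunction, coe_mk]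
    rw [hχ₂4]
    simp
    ring
  rw [hval, hz2, hz4]
  rcases hq₁ with h | h | h <;> rcases hq₂ with h' | h' | h' <;> rw [h, h'] <;> norm_num

/-- The bracket of the error term on the window: for `α ≥ 1/8`, `σ ≤ 1`, `ℓ ≥ 0`,
`ℓ + 1/α + σ(ℓ/α + 1/α²) ≤ 9(ℓ + 8)`. [folklore] -/
private theorem window_bracket_le' {σ α ℓ : ℝ} (hα : 1 / 8 ≤ α) (hσ1 : σ ≤ 1)
    (hℓ : 0 ≤ ℓ) : ℓ + 1 / α + σ * (ℓ / α + 1 / α ^ 2) ≤ 9 * (ℓ + 8) := by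
  have hαpos : 0 < α := by linarith
  have h1 : 1 / α ≤ 8 := by rw [div_le_iff₀ hαpos]; linarith
  have h2 : ℓ / α ≤ 8 * ℓ := by
    rw [div_le_iff₀ hαpos]
    have : ℓ * 1 ≤ ℓ * (8 * α) := mul_le_mul_of_nonneg_left (by linarith) hℓ
    linarith
  have h3 : 1 / α ^ 2 ≤ 64 := by
    have hsq : (1 / 8 : ℝ) ^ 2 ≤ α ^ 2 := pow_le_pow_left₀ (by norm_num) hα 2
    rw [div_le_iff₀ (by positivity)]
    norm_num at hsq
    linarith
  have h4 : σ * (ℓ / α + 1 / α ^ 2) ≤ 1 * (8 * ℓ + 64) :=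
    mul_le_mul hσ1 (by linarith) (by positivity) zero_le_one
  linarith

/-- On the window `(1 − σ) log N ≤ 1`: `N^{−(σ + κ − 1)} ≤ e · N^{−κ}`. [folklore] -/
private theorem rpow_window_le' {N σ κ : ℝ} (hN : 0 < N) (h : (1 - σ) * Real.log N ≤ 1) :
    N ^ (-(σ + κ - 1)) ≤ Real.exp 1 * N ^ (-κ) := by
  have e1 : N ^ (-(σ + κ - 1)) = N ^ (1 - σ) * N ^ (-κ) := by
    rw [← Real.rpow_add hN]; ring_nf
  rw [e1]
  refine mul_le_mul_of_nonneg_right ?_ (Real.rpow_nonneg hN.le _)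
  rw [Real.rpow_def_of_pos hN, Real.exp_le_exp]
  linarith [mul_comm (1 - σ) (Real.log N)]

/-- `(1 + log t)² ≤ 16 t^δ/δ²` for `t ≥ 1`, `0 < δ ≤ 1`. [folklore] -/
private theorem one_add_log_sq_le {t δ : ℝ} (ht : 1 ≤ t) (hδ0 : 0 < δ) (hδ1 : δ ≤ 1) :
    (1 + Real.log t) ^ 2 ≤ 16 / δ ^ 2 * t ^ δ := by
  have ht0 : 0 ≤ t := by linarith
  have hlog := Real.log_le_rpow_div ht0 (half_pos hδ0)
  have hp1 : 1 ≤ t ^ (δ / 2) := Real.one_le_rpow ht (by linarith)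
  have hp0 : 0 ≤ t ^ (δ / 2) := by linarith
  have h1 : 1 + Real.log t ≤ 4 / δ * t ^ (δ / 2) := by
    have h2 : (1 : ℝ) ≤ 2 / δ * t ^ (δ / 2) := by
      have : (1 : ℝ) ≤ 2 / δ := by rw [le_div_iff₀ hδ0]; linarith
      nlinarith
    have h3 : Real.log t ≤ 2 / δ * t ^ (δ / 2) := by
      rw [show 2 / δ * t ^ (δ / 2) = t ^ (δ / 2) / (δ / 2) by field_simp]
      exact hlog
    calc 1 + Real.log t ≤ 2 / δ * t ^ (δ / 2) + 2 / δ * t ^ (δ / 2) := add_le_add h2 h3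
      _ = 4 / δ * t ^ (δ / 2) := by ring
  have h0 : 0 ≤ 1 + Real.log t := by linarith [Real.log_nonneg ht]
  calc (1 + Real.log t) ^ 2 ≤ (4 / δ * t ^ (δ / 2)) ^ 2 := pow_le_pow_left₀ h0 h1 2
    _ = 16 / δ ^ 2 * (t ^ (δ / 2) * t ^ (δ / 2)) := by ring
    _ = 16 / δ ^ 2 * t ^ δ := by rw [← Real.rpow_add (by linarith)]; ring_nf

/-- **`Re F′(σ) < 0` on the window for `F = ζ L(χ₁) L(χ₂) L(χ₁χ₂)`** (Pintz's (4.5), the case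
`F(s) = F(s, χ₁, χ₂)` of p. 96). Data: quadratic non-principal `χ₁, χ₂` with `χ₁χ₂ (mod D₁D₂)`
non-principal; partial-sum bounds `A₁, A₂, A₃ ≥ 1`; `|L(1, χ_i)| ≤ ℓ`; `0 < δ ≤ 1/16`; and a window
parameter `N ≥ e^{16}`, `N ≥ A = A₁A₂A₃` with
`9e · (864 ℓ²/δ²) A^{1/4} · N^{−(1/4 − δ)} (log N + 8) < log 4/4`. Then for
`1 − 1/log N ≤ σ < 1` the function `F` has a derivative at `σ` with negative real part.
[cite: Pintz1977ElementaryVIII, proof of Theorems 4–5, (4.5) p. 96] -/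
theorem landau_hasDerivAt_re_neg (hχ₁ : χ₁ ≠ 1) (hq₁ : χ₁ ^ 2 = 1) (hχ₂ : χ₂ ≠ 1)
    (hq₂ : χ₂ ^ 2 = 1) (hψ : prodChar χ₁ χ₂ ≠ 1) {A₁ A₂ A₃ ℓ δ : ℝ} (hA₁1 : 1 ≤ A₁)
    (hA₂1 : 1 ≤ A₂) (hA₃1 : 1 ≤ A₃) (hℓ1 : 1 ≤ ℓ) (hA₁ : ∀ n, ‖partialSum χ₁ n‖ ≤ A₁)
    (hA₂ : ∀ n, ‖partialSum χ₂ n‖ ≤ A₂) (hA₃ : ∀ n, ‖partialSum (prodChar χ₁ χ₂) n‖ ≤ A₃)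
    (hL₁ : ‖χ₁.LFunction 1‖ ≤ ℓ) (hL₂ : ‖χ₂.LFunction 1‖ ≤ ℓ) (hδ0 : 0 < δ) (hδ : δ ≤ 1 / 16)
    {N : ℕ} (hN : Real.exp 16 ≤ N) (hNA : A₁ * A₂ * A₃ ≤ N)
    (herr : 9 * Real.exp 1 * (864 * ℓ ^ 2 / δ ^ 2 * (A₁ * A₂ * A₃) ^ (1 / 4 : ℝ)) *
      (N : ℝ) ^ (-(1 / 4 - δ)) * (Real.log N + 8) < Real.log 4 / 4)
    {σ : ℝ} (hσN : 1 - 1 / Real.log N ≤ σ) (hσ1 : σ < 1) :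
    ∃ Φ' : ℂ, HasDerivAt (fun s : ℂ => riemannZeta s *
      (χ₁.LFunction s * χ₂.LFunction s * (prodChar χ₁ χ₂).LFunction s)) Φ' σ ∧ Φ'.re < 0 := by
  have hψq : prodChar χ₁ χ₂ ^ 2 = 1 := prodChar_sq_eq_one χ₁ χ₂ hq₁ hq₂
  -- the data of the engine (kept opaque)
  obtain ⟨f, hfdef⟩ : ∃ f : ℕ → ℝ, ∀ n, f n = (coeff χ₁ χ₂ n).re := ⟨_, fun _ => rfl⟩
  set L₁ : ℂ := χ₁.LFunction 1 with hL₁def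
  set L₂ : ℂ := χ₂.LFunction 1 with hL₂def
  set L₃ : ℂ := (prodChar χ₁ χ₂).LFunction 1 with hL₃def
  obtain ⟨a, hadef⟩ : ∃ a : ℝ, a = L₁.re * L₂.re * L₃.re := ⟨_, rfl⟩
  obtain ⟨R, hR⟩ : ∃ R : ℝ → ℝ, ∀ t, R t = (∑ k ∈ Icc 1 ⌊t⌋₊, f k) - a * t := ⟨_, fun _ => rfl⟩
  obtain ⟨I, hI⟩ : ∃ I : ℂ → ℂ,
      ∀ s, I s = ∫ t in Ioi (1 : ℝ), ((R t : ℝ) : ℂ) * (t : ℂ) ^ (-(s + 1)) := ⟨_, fun _ => rfl⟩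
  have hfC : ∀ n, ((f n : ℝ) : ℂ) = coeff χ₁ χ₂ n := fun n => by
    rw [hfdef]; exact ofReal_re_coeff χ₁ χ₂ hq₁ hq₂ n
  have hf : ∀ n, 0 ≤ f n := fun n => by
    rw [hfdef]; exact (Complex.nonneg_iff.mp (coeff_nonneg χ₁ χ₂ hq₁ hq₂ n)).1
  have hf0 : f 0 = 0 := by rw [hfdef]; simp
  have hf4 : 1 ≤ f 4 := by rw [hfdef]; exact one_le_re_coeff_four χ₁ χ₂ hq₁ hq₂
  -- `a = L(1,χ₁)L(1,χ₂)L(1,χ₁χ₂) > 0`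
  have hL₁re : L₁ = ((L₁.re : ℝ) : ℂ) := by
    have := LFunction_ofReal_eq_re χ₁ hχ₁ hq₁ one_pos; rwa [ofReal_one] at this
  have hL₂re : L₂ = ((L₂.re : ℝ) : ℂ) := by
    have := LFunction_ofReal_eq_re χ₂ hχ₂ hq₂ one_pos; rwa [ofReal_one] at this
  have hL₃re : L₃ = ((L₃.re : ℝ) : ℂ) := by
    have := LFunction_ofReal_eq_re (prodChar χ₁ χ₂) hψ hψq one_pos; rwa [ofReal_one] at this
  have haC : ((a : ℝ) : ℂ) = L₁ * L₂ * L₃ := by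
    rw [hadef, hL₁re, hL₂re, hL₃re]; push_cast; simp
  have ha : 0 < a := by
    rw [hadef]
    exact mul_pos (mul_pos (Siegel.LFunction_one_re_pos χ₁ hχ₁ hq₁)
      (Siegel.LFunction_one_re_pos χ₂ hχ₂ hq₂)) (Siegel.LFunction_one_re_pos _ hψ hψq)
  -- numerics of the window
  have hA₁0 : 0 < A₁ := by linarith
  set A : ℝ := A₁ * A₂ * A₃ with hAdef
  have hA1 : 1 ≤ A := by
    have h12 : 1 ≤ A₁ * A₂ := by nlinarith
    rw [hAdef]; nlinarith
  have hA0 : 0 < A := by linarith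
  have hN1r : (1 : ℝ) ≤ N := hA1.trans hNA
  have hN0r : (0 : ℝ) < N := by linarith
  have hN1 : 1 ≤ N := by exact_mod_cast hN1r
  have hN4 : 4 ≤ N := by
    have h16 : (16 : ℝ) ≤ Real.exp 16 := by
      have := Real.add_one_le_exp (16 : ℝ); linarith
    exact_mod_cast (show (4 : ℝ) ≤ N by linarith)
  have hlogN16 : 16 ≤ Real.log N := by
    rw [← Real.log_exp 16]; exact Real.log_le_log (Real.exp_pos 16) hN
  have hlogNpos : 0 < Real.log N := by linarith
  set κ : ℝ := 1 / 4 - δ with hκdef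
  have hκ0 : 0 ≤ κ := by rw [hκdef]; linarith
  set B : ℝ := 864 * ℓ ^ 2 / δ ^ 2 * A ^ (1 / 4 : ℝ) with hBdef
  have hB0 : 0 ≤ B := by positivity
  -- the remainder `R(t) = Re (∑_{n ≤ t} r(n) − L₁L₂L₃ t)`
  have hRre : ∀ t : ℝ, R t = (∑ n ∈ Ioc 0 ⌊t⌋₊, coeff χ₁ χ₂ n - L₁ * L₂ * L₃ * t).re := by
    intro t
    rw [hR, ← haC, Complex.sub_re, Complex.re_sum, show Finset.Icc 1 ⌊t⌋₊ = Finset.Ioc 0 ⌊t⌋₊ by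
      ext k; simp only [Finset.mem_Icc, Finset.mem_Ioc]; omega]
    congr 1
    · exact sum_congr rfl fun n _ => by rw [← hfC n, Complex.ofReal_re]
    · rw [← Complex.ofReal_mul, Complex.ofReal_re]
  have hB : ∀ t : ℝ, A ≤ t → |R t| ≤ B * t ^ (1 - κ) := by
    intro t ht
    have ht1 : 1 ≤ t := hA1.trans ht
    have ht0 : 0 < t := by linarith only [ht1]
    have h := norm_summatory_coeff_sub_le χ₁ χ₂ hχ₁ hq₁ hχ₂ hψ hA₁1 hA₂1 hA₃1 hℓ1 hA₁ hA₂ hA₃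
      hL₁ hL₂ ht
    have hlog := one_add_log_sq_le ht1 hδ0 (by linarith only [hδ])
    rw [hRre]
    refine (abs_re_le_norm _).trans (h.trans ?_)
    have hpow : t ^ (3 / 4 : ℝ) * t ^ δ = t ^ (1 - κ) := by
      rw [← Real.rpow_add ht0, hκdef]; ring_nf
    calc 54 * ℓ ^ 2 * A ^ (1 / 4 : ℝ) * t ^ (3 / 4 : ℝ) * (1 + Real.log t) ^ 2
        ≤ 54 * ℓ ^ 2 * A ^ (1 / 4 : ℝ) * t ^ (3 / 4 : ℝ) * (16 / δ ^ 2 * t ^ δ) :=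
          mul_le_mul_of_nonneg_left hlog (by positivity)
      _ = B * (t ^ (3 / 4 : ℝ) * t ^ δ) := by rw [hBdef]; ring
      _ = B * t ^ (1 - κ) := by rw [hpow]
  -- the global (crude) remainder bound on `t ≥ 1`, by monotonicity of `∑_{k ≤ t} f(k)`
  set K₀ : ℝ := 2 * a * A + B * A ^ (1 - κ) with hK₀def
  have hK₀0 : 0 ≤ K₀ := by positivity
  have hRb : ∀ t : ℝ, 1 ≤ t → |R t| ≤ (B + K₀) * t ^ (1 - κ) := by
    intro t ht1
    have ht0 : 0 < t := by linarith only [ht1]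
    have htp : 1 ≤ t ^ (1 - κ) := Real.one_le_rpow ht1 (by rw [hκdef]; linarith only [hδ0])
    have hBK : B ≤ B + K₀ := by linarith only [hK₀0]
    rcases le_or_gt A t with hAt | hAt
    · calc |R t| ≤ B * t ^ (1 - κ) := hB t hAt
        _ ≤ (B + K₀) * t ^ (1 - κ) := by gcongr
    · -- `1 ≤ t < A`: `|R t| ≤ H(t) + a t ≤ H(A) + a A ≤ 2aA + B A^{1−κ}`
      have hHt : ∑ k ∈ Icc 1 ⌊t⌋₊, f k ≤ ∑ k ∈ Icc 1 ⌊A⌋₊, f k :=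
        sum_le_sum_of_subset_of_nonneg (Finset.Icc_subset_Icc le_rfl (Nat.floor_mono hAt.le))
          (fun k _ _ => hf k)
      have hHA : ∑ k ∈ Icc 1 ⌊A⌋₊, f k ≤ a * A + B * A ^ (1 - κ) := by
        have h1 := hB A le_rfl
        rw [hR] at h1
        have := (abs_le.mp h1).2
        linarith only [this]
      have hH0 : 0 ≤ ∑ k ∈ Icc 1 ⌊t⌋₊, f k := sum_nonneg fun k _ => hf k
      have hat : a * t ≤ a * A := mul_le_mul_of_nonneg_left hAt.le ha.le
      have hat0 : 0 ≤ a * t := by positivity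
      have hBA : 0 ≤ B * A ^ (1 - κ) := by positivity
      have hRt : |R t| ≤ K₀ := by
        rw [hR, abs_le, hK₀def]
        constructor
        · linarith only [hH0, hat, hBA, hat0]
        · linarith only [hHt, hHA, hat0, hat]
      have hKB : K₀ ≤ B + K₀ := by linarith only [hB0]
      calc |R t| ≤ K₀ := hRt
        _ ≤ K₀ * t ^ (1 - κ) := le_mul_of_one_le_right hK₀0 htp
        _ ≤ (B + K₀) * t ^ (1 - κ) := by gcongr
  -- the continued function `G = ζ₁ · L₁ L₂ L₃` and `G = a s + s(s−1) I(s)` on `Re s > 1 − κ`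
  obtain ⟨G, hG⟩ : ∃ G : ℂ → ℂ, ∀ s, G s = riemannZeta₁ s *
      (χ₁.LFunction s * χ₂.LFunction s * (prodChar χ₁ χ₂).LFunction s) := ⟨_, fun _ => rfl⟩
  have hGfun : G = fun s => riemannZeta₁ s *
      (χ₁.LFunction s * χ₂.LFunction s * (prodChar χ₁ χ₂).LFunction s) := funext hG
  have hdiffL : Differentiable ℂ (fun s => χ₁.LFunction s * χ₂.LFunction s *
      (prodChar χ₁ χ₂).LFunction s) :=
    ((DirichletCharacter.differentiable_LFunction hχ₁).mul
      (DirichletCharacter.differentiable_LFunction hχ₂)).mul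
      (DirichletCharacter.differentiable_LFunction hψ)
  have hGd : DifferentiableOn ℂ G {s : ℂ | 1 - κ < s.re} := by
    rw [hGfun]
    exact (differentiable_riemannZeta₁.mul hdiffL).differentiableOn
  have hGL : ∀ s : ℂ, 1 < s.re → G s = (s - 1) * LSeries (fun n => (f n : ℂ)) s := by
    intro s hs
    have hs1 : s ≠ 1 := by intro h; rw [h] at hs; simp at hs
    have hLS : LSeries (fun n => (f n : ℂ)) s = LSeries (fun n => coeff χ₁ χ₂ n) s :=
      LSeries_congr (fun {n} _ => hfC n) s
    rw [hG, hLS, LSeries_coeff_eq χ₁ χ₂ hs, riemannZeta_eq_inv_sub_mul hs1]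
    field_simp
  -- `F(s) = Φ(s) := a s/(s−1) + s I(s)` off `s = 1` on the half-plane
  have hΦ : ∀ s : ℂ, 1 - κ < s.re → s ≠ 1 →
      riemannZeta s * (χ₁.LFunction s * χ₂.LFunction s * (prodChar χ₁ χ₂).LFunction s) =
        a * s / (s - 1) + s * I s := by
    intro s hs hs1
    have hs1' : s - 1 ≠ 0 := sub_ne_zero.mpr hs1
    have hGs := continuation_eq hf hR hRb hκ0 hI hGd hGL hs
    rw [hG] at hGs
    rw [riemannZeta_eq_inv_sub_mul hs1, mul_assoc, hGs]
    field_simp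
  -- the point `σ`
  have h116 : 1 / Real.log N ≤ 1 / 16 := by
    rw [div_le_div_iff₀ hlogNpos (by norm_num)]; linarith only [hlogN16]
  have hσlo : (15 : ℝ) / 16 ≤ σ := by linarith only [h116, hσN]
  have hσκ : 1 - κ < σ := by rw [hκdef]; linarith only [hσlo, hδ]
  have hσκ' : 1 - κ < ((σ : ℂ)).re := by simpa using hσκ
  have hσ1' : (σ : ℂ) ≠ 1 := by
    intro h; have := congrArg Complex.re h; simp at this; linarith only [this, hσ1]
  have hD := hasDerivAt_continuation hR hRb hI hσκ' hσ1'
  refine ⟨_, hD.congr_of_eventuallyEq ?_, ?_⟩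
  · have hopen : IsOpen ({s : ℂ | 1 - κ < s.re} ∩ {s : ℂ | s ≠ 1}) :=
      (isOpen_lt continuous_const Complex.continuous_re).inter isOpen_ne
    have hmem : (σ : ℂ) ∈ {s : ℂ | 1 - κ < s.re} ∩ {s : ℂ | s ≠ 1} := ⟨hσκ', hσ1'⟩
    filter_upwards [hopen.mem_nhds hmem] with s hs
    exact hΦ s hs.1 hs.2
  · have hBN : ∀ t : ℝ, (N : ℝ) ≤ t → |R t| ≤ B * t ^ (1 - κ) := fun t ht => hB t (hNA.trans ht)
    have hle := re_deriv_le hf hf0 hf4 ha.le hR hRb hI hN4 hBN hσκ (by linarith only [hσlo])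
      hσ1 hσN
    -- `α = σ + κ − 1 ≥ 1/8`
    have hα : 1 / 8 ≤ σ + κ - 1 := by rw [hκdef]; linarith only [hσlo, hδ]
    have h1σ : (1 - σ) * Real.log N ≤ 1 := by
      have : 1 - σ ≤ 1 / Real.log N := by linarith only [hσN]
      calc (1 - σ) * Real.log N ≤ (1 / Real.log N) * Real.log N :=
            mul_le_mul_of_nonneg_right this hlogNpos.le
        _ = 1 := by field_simp
    have hNpow := rpow_window_le' (κ := κ) hN0r h1σ
    have hbr := window_bracket_le' (ℓ := Real.log N) hα hσ1.le hlogNpos.le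
    have hbr0 : 0 ≤ Real.log N + 1 / (σ + κ - 1) +
        σ * (Real.log N / (σ + κ - 1) + 1 / (σ + κ - 1) ^ 2) := by
      have hσ0 : 0 ≤ σ := by linarith only [hσlo]
      have hαpos : 0 < σ + κ - 1 := by linarith only [hα]
      positivity
    have hE : B * (N : ℝ) ^ (-(σ + κ - 1)) *
        (Real.log N + 1 / (σ + κ - 1) + σ * (Real.log N / (σ + κ - 1) + 1 / (σ + κ - 1) ^ 2))
        < Real.log 4 / 4 := by
      calc B * (N : ℝ) ^ (-(σ + κ - 1)) *
          (Real.log N + 1 / (σ + κ - 1) + σ * (Real.log N / (σ + κ - 1) + 1 / (σ + κ - 1) ^ 2))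
          ≤ B * (Real.exp 1 * (N : ℝ) ^ (-κ)) * (9 * (Real.log N + 8)) := by gcongr
        _ = 9 * Real.exp 1 * B * (N : ℝ) ^ (-κ) * (Real.log N + 8) := by ring
        _ < Real.log 4 / 4 := herr
    linarith only [hle, hE]

/-- **The window conclusion for `F(s, χ₁, χ₂)`** (Pintz p. 96: "`F(s)` has at most one, simple
zero in the interval `[1 − (1 − o(1))/log A, 1]`", applied to `F(s) = F(s, χ₁, χ₂)`): under the
hypotheses of `landau_hasDerivAt_re_neg`, `L(s, χ₁)` and `L(s, χ₂)` cannot both vanish at real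
points of `[1 − 1/log N, 1)` — two distinct such zeros of `F` contradict Rolle, and a common zero
`β` would be a double zero of `F`, `F′(β) = 0`, contradicting `Re F′(β) < 0`.
[cite: Pintz1977ElementaryVIII, Theorem 5 p. 90, proof p. 96] -/
theorem landau_window (hχ₁ : χ₁ ≠ 1) (hq₁ : χ₁ ^ 2 = 1) (hχ₂ : χ₂ ≠ 1)
    (hq₂ : χ₂ ^ 2 = 1) (hψ : prodChar χ₁ χ₂ ≠ 1) {A₁ A₂ A₃ ℓ δ : ℝ} (hA₁1 : 1 ≤ A₁)
    (hA₂1 : 1 ≤ A₂) (hA₃1 : 1 ≤ A₃) (hℓ1 : 1 ≤ ℓ) (hA₁ : ∀ n, ‖partialSum χ₁ n‖ ≤ A₁)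
    (hA₂ : ∀ n, ‖partialSum χ₂ n‖ ≤ A₂) (hA₃ : ∀ n, ‖partialSum (prodChar χ₁ χ₂) n‖ ≤ A₃)
    (hL₁ : ‖χ₁.LFunction 1‖ ≤ ℓ) (hL₂ : ‖χ₂.LFunction 1‖ ≤ ℓ) (hδ0 : 0 < δ) (hδ : δ ≤ 1 / 16)
    {N : ℕ} (hN : Real.exp 16 ≤ N) (hNA : A₁ * A₂ * A₃ ≤ N)
    (herr : 9 * Real.exp 1 * (864 * ℓ ^ 2 / δ ^ 2 * (A₁ * A₂ * A₃) ^ (1 / 4 : ℝ)) *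
      (N : ℝ) ^ (-(1 / 4 - δ)) * (Real.log N + 8) < Real.log 4 / 4)
    {β₁ β₂ : ℝ} (h₁ : 1 - 1 / Real.log N ≤ β₁) (h₁' : β₁ < 1) (h₂ : 1 - 1 / Real.log N ≤ β₂)
    (h₂' : β₂ < 1) (hz₁ : χ₁.LFunction (β₁ : ℂ) = 0) (hz₂ : χ₂.LFunction (β₂ : ℂ) = 0) :
    False := by
  set F : ℂ → ℂ := fun s : ℂ => riemannZeta s *
    (χ₁.LFunction s * χ₂.LFunction s * (prodChar χ₁ χ₂).LFunction s) with hFdef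
  have hderiv : ∀ σ : ℝ, 1 - 1 / Real.log N ≤ σ → σ < 1 →
      ∃ Φ' : ℂ, HasDerivAt F Φ' σ ∧ Φ'.re < 0 :=
    fun σ hσ hσ' => landau_hasDerivAt_re_neg χ₁ χ₂ hχ₁ hq₁ hχ₂ hq₂ hψ hA₁1 hA₂1 hA₃1 hℓ1 hA₁ hA₂
      hA₃ hL₁ hL₂ hδ0 hδ hN hNA herr hσ hσ'
  -- Rolle: `β₁ = β₂`
  have hF₁ : F (β₁ : ℂ) = 0 := by simp only [hFdef, hz₁, zero_mul, mul_zero]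
  have hF₂ : F (β₂ : ℂ) = 0 := by simp only [hFdef, hz₂, mul_zero, zero_mul]
  have heq : β₁ = β₂ := by
    set lo : ℝ := 1 - 1 / Real.log N with hlo
    set hi : ℝ := max β₁ β₂ with hhi
    have hhi1 : hi < 1 := max_lt h₁' h₂'
    have hF : ∀ σ : ℝ, σ ∈ Set.Icc lo hi → ∃ Φ' : ℂ, HasDerivAt F Φ' σ ∧ Φ'.re < 0 :=
      fun σ hσ => hderiv σ hσ.1 (lt_of_le_of_lt hσ.2 hhi1)
    choose! Φ' hΦ'd hΦ'neg using hF
    exact eq_of_zeros_of_re_deriv_neg (F := F) (F' := fun s => Φ' s.re) (lo := lo) (hi := hi)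
      (fun σ hσ => by simpa using hΦ'd σ hσ) (fun σ hσ => by simpa using hΦ'neg σ hσ)
      ⟨h₁, le_max_left _ _⟩ ⟨h₂, le_max_right _ _⟩ hF₁ hF₂
  subst heq
  -- a common zero of `L(χ₁)` and `L(χ₂)` is a double zero of `F`
  obtain ⟨Φ', hΦ'd, hΦ'neg⟩ := hderiv β₁ h₁ h₁'
  have hβ1' : (β₁ : ℂ) ≠ 1 := by
    intro h; have := congrArg Complex.re h; simp at this; linarith
  have hζ := (differentiableAt_riemannZeta hβ1').hasDerivAt
  have hL1 := ((DirichletCharacter.differentiable_LFunction hχ₁) (β₁ : ℂ)).hasDerivAt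
  have hL2 := ((DirichletCharacter.differentiable_LFunction hχ₂) (β₁ : ℂ)).hasDerivAt
  have hL3 := ((DirichletCharacter.differentiable_LFunction hψ) (β₁ : ℂ)).hasDerivAt
  have hprod := hζ.mul ((hL1.mul hL2).mul hL3)
  have huniq := hΦ'd.unique hprod
  simp only [Pi.mul_apply, hz₁, hz₂, zero_mul, mul_zero, add_zero] at huniq
  rw [huniq] at hΦ'neg
  simp at hΦ'neg

end LandauWindow

/-! ## Part D. Theorem 5 (Landau, `c′ = 1 + o(1)`): the choice `x = (D₁D₂)^{1/(1−η)}` and the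
asymptotic verification of the window conditions -/

section LandauAssembly

open DirichletAbel RealChar SiegelCoefficients

/-- `(1 + log x)/x^u → 0` (`u > 0`). [folklore] -/
private theorem tendsto_one_add_log_div_rpow' {u : ℝ} (hu : 0 < u) :
    Tendsto (fun x : ℝ => (1 + Real.log x) / x ^ u) atTop (𝓝 0) := by
  have h1 : Tendsto (fun x : ℝ => x ^ (-u)) atTop (𝓝 0) := tendsto_rpow_neg_atTop hu
  have h2 := (isLittleO_log_rpow_atTop hu).tendsto_div_nhds_zero
  have h := h1.add h2
  rw [add_zero] at h
  refine h.congr' ?_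
  filter_upwards [eventually_gt_atTop 0] with x hx
  rw [Real.rpow_neg hx.le, add_div, inv_eq_one_div]

/-- `((1 + log x)/x^u)^n = (1 + log x)^n · x^{−nu}` for `x > 0`. [folklore] -/
private theorem one_add_log_div_rpow_pow {x u : ℝ} (hx : 0 < x) (n : ℕ) :
    ((1 + Real.log x) / x ^ u) ^ n = (1 + Real.log x) ^ n * x ^ (-(n * u)) := by
  rw [div_pow, ← Real.rpow_natCast (x ^ u), ← Real.rpow_mul hx.le, Real.rpow_neg hx.le,
    div_eq_mul_inv, mul_comm u]

/-- **The three window conditions for `N = ⌊Q^{1/(1−η)}⌋`, all large `Q`** (`0 < η ≤ 1/2`,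
`δ = ν = η/64`, divisor bound `τ(Q) ≤ C Q^ν`): `N ≥ e^{16}`, `A = τ(Q) Q (1 + log Q)³ ≤ N`, and
`9e (864(1+log Q)²/δ²) A^{1/4} N^{−(1/4−δ)} (log N + 8) < log 4/4`. [folklore] -/
private theorem exists_landau_conditions_nat {η : ℝ} (hη0 : 0 < η) (hη1 : η ≤ 1 / 2) :
    ∃ Q₀ : ℕ, ∀ Q : ℕ, Q₀ ≤ Q →
      Real.exp 16 ≤ (⌊(Q : ℝ) ^ (1 / (1 - η))⌋₊ : ℕ) ∧
      ((ArithmeticFunction.sigma 0 Q : ℕ) : ℝ) * Q * (1 + Real.log Q) ^ 3 ≤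
        (⌊(Q : ℝ) ^ (1 / (1 - η))⌋₊ : ℕ) ∧
      9 * Real.exp 1 * (864 * (1 + Real.log Q) ^ 2 / (η / 64) ^ 2 *
          (((ArithmeticFunction.sigma 0 Q : ℕ) : ℝ) * Q * (1 + Real.log Q) ^ 3) ^ (1 / 4 : ℝ)) *
        ((⌊(Q : ℝ) ^ (1 / (1 - η))⌋₊ : ℕ) : ℝ) ^ (-(1 / 4 - η / 64)) *
        (Real.log ((⌊(Q : ℝ) ^ (1 / (1 - η))⌋₊ : ℕ) : ℝ) + 8) < Real.log 4 / 4 := by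
  obtain ⟨C, hC1, hC⟩ :=
    Literature.NumberTheory.Sieve.exists_sigma_zero_le_mul_rpow (ε := η / 64) (by positivity)
  have hC0 : 0 < C := by linarith
  set e : ℝ := 1 / (1 - η) with hedef
  set ν : ℝ := η / 64 with hνdef
  have h1η : 0 < 1 - η := by linarith
  have he1 : 1 < e := by rw [hedef, lt_div_iff₀ h1η]; linarith
  have he2 : e ≤ 2 := by rw [hedef, div_le_iff₀ h1η]; linarith
  have he0 : 0 < e := by linarith
  have hν0 : 0 < ν := by positivity
  have hν1 : ν ≤ 1 / 16 := by rw [hνdef]; linarith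
  -- the saving `γ = e(1/4 − ν) − (1 + ν)/4 > 0`
  set γ : ℝ := e * (1 / 4 - ν) - (1 + ν) / 4 with hγdef
  have hγ0 : 0 < γ := by
    have hk : (1 + ν) / 4 * (1 - η) < 1 / 4 - ν := by rw [hνdef]; nlinarith
    have : (1 + ν) / 4 < e * (1 / 4 - ν) := by
      rw [hedef, one_div_mul_eq_div, lt_div_iff₀ h1η]; exact hk
    linarith
  have hu0 : 0 < (e - 1 - ν) / 3 := by
    have : ν < e - 1 := by
      have h' : η < e - 1 := by
        rw [hedef, lt_sub_iff_add_lt, lt_div_iff₀ h1η]; nlinarith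
      linarith
    linarith
  set K : ℝ := 124416 * Real.exp 1 * C / ν ^ 2 with hKdef
  have hK0 : 0 < K := by positivity
  have hlog4 : 0 < Real.log 4 / 4 := by positivity
  -- the three real conditions, eventually
  have h1 : ∀ᶠ x : ℝ in atTop, 2 * Real.exp 16 ≤ x ^ e :=
    (tendsto_rpow_atTop he0).eventually_ge_atTop _
  have h2 : ∀ᶠ x : ℝ in atTop, ((1 + Real.log x) / x ^ ((e - 1 - ν) / 3)) ^ 3 < 1 / (2 * C) :=
    (tendsto_order.1 (((tendsto_one_add_log_div_rpow' hu0).pow 3).congr' (by simp))).2 _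
      (by rw [zero_pow three_ne_zero]; positivity)
  have h3 : ∀ᶠ x : ℝ in atTop, ((1 + Real.log x) / x ^ (γ / 4)) ^ 4 < Real.log 4 / 4 / K :=
    (tendsto_order.1 (((tendsto_one_add_log_div_rpow' (by positivity : 0 < γ / 4)).pow 4).congr'
      (by simp))).2 _ (by rw [zero_pow four_ne_zero]; positivity)
  obtain ⟨x₀, hx₀⟩ := Filter.eventually_atTop.mp ((h1.and (h2.and h3)).and (eventually_ge_atTop 1))
  refine ⟨⌈x₀⌉₊, fun Q hQ => ?_⟩
  have hQx : x₀ ≤ (Q : ℝ) := (Nat.le_ceil x₀).trans (by exact_mod_cast hQ)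
  obtain ⟨⟨hQ1, hQ2, hQ3⟩, hQone⟩ := hx₀ Q hQx
  have hQ0 : (0 : ℝ) < Q := by linarith
  have hQne : (Q : ℕ) ≠ 0 := by exact_mod_cast hQ0.ne'
  have hlogQ : 0 ≤ Real.log Q := Real.log_nonneg hQone
  set ℓ : ℝ := 1 + Real.log Q with hℓdef
  have hℓ1 : 1 ≤ ℓ := by linarith
  have hℓ0 : 0 < ℓ := by linarith
  -- the window `N = ⌊Q^e⌋`
  set y : ℝ := (Q : ℝ) ^ e with hy
  have hy0 : 0 < y := Real.rpow_pos_of_pos hQ0 _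
  set N := ⌊y⌋₊ with hN
  have hNy : (N : ℝ) ≤ y := Nat.floor_le hy0.le
  have hNgt : y - 1 < N := by have := Nat.lt_floor_add_one y; linarith
  have hexp16 : (16 : ℝ) ≤ Real.exp 16 := by have := Real.add_one_le_exp (16 : ℝ); linarith
  have hNhalf : y / 2 ≤ N := by linarith
  have hN0 : (0 : ℝ) < N := by linarith
  have hNe : Real.exp 16 ≤ N := by linarith
  -- the divisor bound
  have hτ : ((ArithmeticFunction.sigma 0 Q : ℕ) : ℝ) ≤ C * (Q : ℝ) ^ ν := hC Q
  set A : ℝ := ((ArithmeticFunction.sigma 0 Q : ℕ) : ℝ) * Q * ℓ ^ 3 with hAdef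
  have hτ1 : (1 : ℝ) ≤ ((ArithmeticFunction.sigma 0 Q : ℕ) : ℝ) := by
    have : 0 < ArithmeticFunction.sigma 0 Q := by
      rw [ArithmeticFunction.sigma_zero_apply]; exact Finset.card_pos.mpr ⟨1, Nat.one_mem_divisors.mpr hQne⟩
    exact_mod_cast this
  have hA0 : 0 < A := by positivity
  have hAle : A ≤ C * (Q : ℝ) ^ (1 + ν) * ℓ ^ 3 := by
    rw [hAdef, show (1 : ℝ) + ν = ν + 1 by ring, Real.rpow_add_one hQ0.ne', ← mul_assoc]
    exact mul_le_mul_of_nonneg_right (mul_le_mul_of_nonneg_right hτ hQ0.le) (by positivity)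
  -- (b): `A ≤ N`
  have hb : A ≤ N := by
    have hpos : 0 < (Q : ℝ) ^ ((e - 1 - ν) / 3) := Real.rpow_pos_of_pos hQ0 _
    rw [one_add_log_div_rpow_pow hQ0 3] at hQ2
    -- `ℓ³ Q^{−(e−1−ν)} < 1/(2C)`, i.e. `2C ℓ³ < Q^{e−1−ν}`
    have hQpow : 0 < (Q : ℝ) ^ (-(3 * ((e - 1 - ν) / 3))) := Real.rpow_pos_of_pos hQ0 _
    have h2C : 2 * C * ℓ ^ 3 ≤ (Q : ℝ) ^ (e - 1 - ν) := by
      have h' : ℓ ^ 3 * (Q : ℝ) ^ (-(3 * ((e - 1 - ν) / 3))) * (2 * C) < 1 := by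
        have := mul_lt_mul_of_pos_right hQ2 (by positivity : (0 : ℝ) < 2 * C)
        rwa [div_mul_cancel₀ _ (by positivity : (2 : ℝ) * C ≠ 0)] at this
      have hid : (Q : ℝ) ^ (-(3 * ((e - 1 - ν) / 3))) * (Q : ℝ) ^ (e - 1 - ν) = 1 := by
        rw [← Real.rpow_add hQ0]; ring_nf; exact Real.rpow_zero _
      have hQp : 0 < (Q : ℝ) ^ (e - 1 - ν) := Real.rpow_pos_of_pos hQ0 _
      have h'' := mul_lt_mul_of_pos_right h' hQp
      rw [one_mul, show ℓ ^ 3 * (Q : ℝ) ^ (-(3 * ((e - 1 - ν) / 3))) * (2 * C) *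
          (Q : ℝ) ^ (e - 1 - ν) = 2 * C * ℓ ^ 3 * ((Q : ℝ) ^ (-(3 * ((e - 1 - ν) / 3))) *
          (Q : ℝ) ^ (e - 1 - ν)) by ring, hid, mul_one] at h''
      exact h''.le
    have hye : y = (Q : ℝ) ^ (1 + ν) * (Q : ℝ) ^ (e - 1 - ν) := by
      rw [hy, ← Real.rpow_add hQ0]; ring_nf
    have hQ1ν : 0 < (Q : ℝ) ^ (1 + ν) := Real.rpow_pos_of_pos hQ0 _
    calc A ≤ C * (Q : ℝ) ^ (1 + ν) * ℓ ^ 3 := hAle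
      _ = (Q : ℝ) ^ (1 + ν) * (2 * C * ℓ ^ 3) / 2 := by ring
      _ ≤ (Q : ℝ) ^ (1 + ν) * (Q : ℝ) ^ (e - 1 - ν) / 2 := by gcongr
      _ = y / 2 := by rw [hye]
      _ ≤ N := hNhalf
  refine ⟨hNe, hb, ?_⟩
  -- (c): the error term
  have hA4 : A ^ (1 / 4 : ℝ) ≤ C * (Q : ℝ) ^ ((1 + ν) / 4) * ℓ := by
    have hz0 : 0 ≤ C * (Q : ℝ) ^ ((1 + ν) / 4) * ℓ := by positivity
    have hz4 : (C * (Q : ℝ) ^ ((1 + ν) / 4) * ℓ) ^ 4 = C ^ 4 * (Q : ℝ) ^ (1 + ν) * ℓ ^ 4 := by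
      rw [mul_pow, mul_pow, ← Real.rpow_natCast ((Q : ℝ) ^ ((1 + ν) / 4)),
        ← Real.rpow_mul hQ0.le]
      norm_num
    have hAle' : A ≤ (C * (Q : ℝ) ^ ((1 + ν) / 4) * ℓ) ^ 4 := by
      rw [hz4]
      have hC4 : C ≤ C ^ 4 := le_self_pow₀ hC1 (by norm_num)
      have hℓ4 : ℓ ^ 3 ≤ ℓ ^ 4 := pow_le_pow_right₀ hℓ1 (by norm_num)
      have hQ1ν : 0 ≤ (Q : ℝ) ^ (1 + ν) := (Real.rpow_pos_of_pos hQ0 _).le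
      calc A ≤ C * (Q : ℝ) ^ (1 + ν) * ℓ ^ 3 := hAle
        _ ≤ C ^ 4 * (Q : ℝ) ^ (1 + ν) * ℓ ^ 4 := by gcongr
    calc A ^ (1 / 4 : ℝ) ≤ ((C * (Q : ℝ) ^ ((1 + ν) / 4) * ℓ) ^ 4) ^ (1 / 4 : ℝ) :=
          Real.rpow_le_rpow hA0.le hAle' (by norm_num)
      _ = C * (Q : ℝ) ^ ((1 + ν) / 4) * ℓ := by
          rw [show (1 / 4 : ℝ) = ((4 : ℕ) : ℝ)⁻¹ by norm_num]
          exact Real.pow_rpow_inv_natCast hz0 four_ne_zero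
  have hNpow : (N : ℝ) ^ (-(1 / 4 - ν)) ≤ 2 * (Q : ℝ) ^ (-(e * (1 / 4 - ν))) := by
    have hκ0 : 0 ≤ 1 / 4 - ν := by linarith
    have h1 : (N : ℝ) ^ (-(1 / 4 - ν)) ≤ (y / 2) ^ (-(1 / 4 - ν)) :=
      Real.rpow_le_rpow_of_nonpos (by positivity) hNhalf (by linarith)
    have h2 : (y / 2) ^ (-(1 / 4 - ν)) = (2 : ℝ) ^ (1 / 4 - ν) * (Q : ℝ) ^ (-(e * (1 / 4 - ν))) := by
      rw [Real.div_rpow hy0.le (by norm_num), Real.rpow_neg (by norm_num : (0 : ℝ) ≤ 2), div_inv_eq_mul,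
        mul_comm, hy, ← Real.rpow_mul hQ0.le]
      ring_nf
    have h3 : (2 : ℝ) ^ (1 / 4 - ν) ≤ 2 := by
      calc (2 : ℝ) ^ (1 / 4 - ν) ≤ (2 : ℝ) ^ (1 : ℝ) :=
            Real.rpow_le_rpow_of_exponent_le (by norm_num) (by linarith)
        _ = 2 := Real.rpow_one 2
    calc (N : ℝ) ^ (-(1 / 4 - ν)) ≤ (y / 2) ^ (-(1 / 4 - ν)) := h1
      _ = (2 : ℝ) ^ (1 / 4 - ν) * (Q : ℝ) ^ (-(e * (1 / 4 - ν))) := h2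
      _ ≤ 2 * (Q : ℝ) ^ (-(e * (1 / 4 - ν))) := by gcongr
  have hlogN : Real.log N + 8 ≤ 8 * ℓ := by
    have h1 : Real.log N ≤ e * Real.log Q := by
      calc Real.log N ≤ Real.log y := Real.log_le_log hN0 hNy
        _ = e * Real.log Q := by rw [hy, Real.log_rpow hQ0]
    have h2 : e * Real.log Q ≤ 2 * Real.log Q := mul_le_mul_of_nonneg_right he2 hlogQ
    rw [hℓdef]; linarith only [h1, h2, hlogQ]
  have hQγ : (Q : ℝ) ^ ((1 + ν) / 4) * (Q : ℝ) ^ (-(e * (1 / 4 - ν))) = (Q : ℝ) ^ (-γ) := by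
    rw [← Real.rpow_add hQ0, hγdef]; ring_nf
  have hfin : K * (ℓ ^ 4 * (Q : ℝ) ^ (-γ)) < Real.log 4 / 4 := by
    rw [one_add_log_div_rpow_pow hQ0 4, show ((4 : ℕ) : ℝ) * (γ / 4) = γ by push_cast; ring] at hQ3
    have := mul_lt_mul_of_pos_left hQ3 hK0
    rwa [mul_div_cancel₀ _ hK0.ne'] at this
  calc 9 * Real.exp 1 * (864 * ℓ ^ 2 / ν ^ 2 * A ^ (1 / 4 : ℝ)) * (N : ℝ) ^ (-(1 / 4 - ν)) *
        (Real.log N + 8)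
      ≤ 9 * Real.exp 1 * (864 * ℓ ^ 2 / ν ^ 2 * (C * (Q : ℝ) ^ ((1 + ν) / 4) * ℓ)) *
          (2 * (Q : ℝ) ^ (-(e * (1 / 4 - ν)))) * (8 * ℓ) := by
        have : 0 ≤ Real.log N + 8 := by linarith [Real.log_nonneg (show (1 : ℝ) ≤ N by linarith)]
        gcongr
    _ = K * (ℓ ^ 4 * ((Q : ℝ) ^ ((1 + ν) / 4) * (Q : ℝ) ^ (-(e * (1 / 4 - ν))))) := by
        rw [hKdef]; field_simp; ring
    _ = K * (ℓ ^ 4 * (Q : ℝ) ^ (-γ)) := by rw [hQγ]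
    _ < Real.log 4 / 4 := hfin

/-- A real zero `1 − δ` of `L(s, χ)`, `χ ≠ χ₀`, has `δ > 0` (no zeros on `Re s ≥ 1`). [folklore] -/
private theorem pos_of_LFunction_zero {q : ℕ} [NeZero q] (χ : DirichletCharacter ℂ q) (hχ : χ ≠ 1)
    {δ : ℝ} (hz : χ.LFunction ((1 - δ : ℝ) : ℂ) = 0) : 0 < δ := by
  by_contra h
  push Not at h
  exact DirichletCharacter.LFunction_ne_zero_of_one_le_re χ (Or.inl hχ)
    (by simp only [Complex.ofReal_re]; linarith) hz

/-- For `L = ζ` (the character mod `1`), a real zero `1 − δ` has `δ > 1`: `ζ(σ) ≠ 0` for real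
`σ ≥ 0` (Mathlib for `σ ≥ 1` and `σ = 0`, the tree's `ZetaRealAxis` for `0 < σ < 1`). [folklore] -/
private theorem one_lt_of_zeta_zero {δ : ℝ} (hz : riemannZeta ((1 - δ : ℝ) : ℂ) = 0) : 1 < δ := by
  by_contra h
  push Not at h
  rcases lt_or_ge (1 - δ) 1 with h1 | h1
  · exact riemannZeta_ofReal_ne_zero_of_nonneg_of_lt_one (by linarith) h1 hz
  · exact riemannZeta_ne_zero_of_one_le_re (by simp only [Complex.ofReal_re]; exact h1) hz

end LandauAssembly

end Pintz1977RealZeros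

/-! ## Part E. The discharge `pintz1977RealZeros_theorem5_holds` -/

section Discharge

open DirichletAbel RealChar SiegelCoefficients Pintz1977RealZeros

/-- **Pintz 1977 (VIII), Theorem 5 (Landau, `c′ = 1 + o(1)`) — PROVED.** For every `η > 0` there is
`A₀` such that for real primitive characters `χ₁ mod D₁ ≠ χ₂ mod D₂` with `D₁D₂ ≥ A₀` and real zeros
`L(1 − δ₁, χ₁) = L(1 − δ₂, χ₂) = 0`: `max(δ₁, δ₂) > (1 − η)/log D₁D₂`. Proof as printed (p. 96): the
§4 engine for `F(s) = F(s, χ₁, χ₂)` with Lemma 1 for `j = 3` at Pólya–Vinogradov strength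
(`A = A₁A₂A₃ = (D₁D₂)^{1+o(1)}`) and the window `x = A^{1+ε}`, here `N = ⌊(D₁D₂)^{1/(1−η)}⌋`; two
zeros of `F` in the window are excluded by `Re F′ < 0` (Rolle), a common zero of `L(χ₁)`, `L(χ₂)`
by `F′ ≠ 0`. The degenerate level `D_i = 1` (`χ_i = χ₀`, `L = ζ`, admitted by the typed
hypotheses) is settled by `ζ(σ) ≠ 0` for `σ ≥ 0`. [cite: Pintz1977ElementaryVIII, Theorem 5 p. 90; proof §4 p. 96] -/
theorem pintz1977RealZeros_theorem5_holds : pintz1977RealZeros_theorem5 := by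
  intro η hη
  -- WLOG `η ≤ 1/2`
  set η' : ℝ := min η (1 / 2) with hη'def
  have hη'0 : 0 < η' := lt_min hη (by norm_num)
  have hη'1 : η' ≤ 1 / 2 := min_le_right _ _
  have hη'η : η' ≤ η := min_le_left _ _
  obtain ⟨Q₀, hQ₀⟩ := exists_landau_conditions_nat hη'0 hη'1
  refine ⟨max Q₀ 3, ?_⟩
  intro D₁ D₂ _ _ hQ χ₁ χ₂ hχ₁q hχ₁p hχ₂q hχ₂p hne δ₁ δ₂ hz₁ hz₂
  have hQ₀Q : Q₀ ≤ D₁ * D₂ := le_trans (le_max_left _ _) hQ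
  have hQ3 : 3 ≤ D₁ * D₂ := le_trans (le_max_right _ _) hQ
  have hQ3r : (3 : ℝ) ≤ ((D₁ * D₂ : ℕ) : ℝ) := by exact_mod_cast hQ3
  have hQ0r : (0 : ℝ) < ((D₁ * D₂ : ℕ) : ℝ) := by linarith
  have hlogQ1 : 1 ≤ Real.log ((D₁ * D₂ : ℕ) : ℝ) := by
    rw [← Real.log_exp 1]
    refine Real.log_le_log (Real.exp_pos 1) ?_
    have := Real.exp_one_lt_d9; linarith
  have hlogQ0 : 0 < Real.log ((D₁ * D₂ : ℕ) : ℝ) := by linarith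
  have hcast : Real.log ((D₁ : ℝ) * D₂) = Real.log ((D₁ * D₂ : ℕ) : ℝ) := by push_cast; ring_nf
  rw [hcast]
  suffices hmain : (1 - η') / Real.log ((D₁ * D₂ : ℕ) : ℝ) < max δ₁ δ₂ by
    refine lt_of_le_of_lt ?_ hmain
    exact div_le_div_of_nonneg_right (by linarith) hlogQ0.le
  -- the degenerate levels `D_i = 1` (`χ_i = χ₀ mod 1`, `L = ζ`)
  have htriv : ∀ {δ : ℝ}, riemannZeta ((1 - δ : ℝ) : ℂ) = 0 →
      (1 - η') / Real.log ((D₁ * D₂ : ℕ) : ℝ) < δ := by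
    intro δ hz
    have hδ := one_lt_of_zeta_zero hz
    have : (1 - η') / Real.log ((D₁ * D₂ : ℕ) : ℝ) ≤ 1 := by
      rw [div_le_one hlogQ0]; linarith
    linarith
  by_cases hD₁ : D₁ = 1
  · subst hD₁
    have h1 : χ₁ = 1 := DirichletCharacter.level_one χ₁
    rw [h1, DirichletCharacter.LFunction_modOne_eq] at hz₁
    exact lt_max_of_lt_left (htriv hz₁)
  by_cases hD₂ : D₂ = 1
  · subst hD₂
    have h2 : χ₂ = 1 := DirichletCharacter.level_one χ₂
    rw [h2, DirichletCharacter.LFunction_modOne_eq] at hz₂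
    exact lt_max_of_lt_right (htriv hz₂)
  -- the main case: `D₁, D₂ ≥ 2`, `χ₁, χ₂` non-principal quadratic, `χ₁χ₂` non-principal
  have hD₁2 : 2 ≤ D₁ := by have := NeZero.ne D₁; omega
  have hD₂2 : 2 ≤ D₂ := by have := NeZero.ne D₂; omega
  have hχ₁ : χ₁ ≠ 1 := by
    intro h
    rw [h, DirichletCharacter.isPrimitive_def, DirichletCharacter.conductor_one] at hχ₁p
    omega
  have hχ₂ : χ₂ ≠ 1 := by
    intro h
    rw [h, DirichletCharacter.isPrimitive_def, DirichletCharacter.conductor_one] at hχ₂p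
    omega
  have hq₁ : χ₁ ^ 2 = 1 := MulChar.isQuadratic_iff_sq_eq_one.mp hχ₁q
  have hq₂ : χ₂ ^ 2 = 1 := MulChar.isQuadratic_iff_sq_eq_one.mp hχ₂q
  have hψ : prodChar χ₁ χ₂ ≠ 1 := by
    by_cases hD : D₁ = D₂
    · subst hD
      intro hψ1
      apply hne
      have hmul : χ₁ * χ₂ = 1 := by
        have hinj := DirichletCharacter.changeLevel_injective (R := ℂ) (dvd_mul_right D₁ D₁)
        apply hinj
        rw [map_mul, map_one]
        exact hψ1
      have hinv : χ₁⁻¹ = χ₁ := by rw [inv_eq_iff_mul_eq_one, ← sq, hq₁]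
      have h12 : χ₁ = χ₂ := by
        calc χ₁ = χ₁⁻¹ := hinv.symm
          _ = χ₂ := inv_eq_of_mul_eq_one_right hmul
      rw [h12]
    · exact DirichletZFR.prodChar_ne_one_of_isPrimitive χ₁ hχ₁p χ₂ hχ₂p hq₂ hD
  have hδ₁0 : 0 < δ₁ := pos_of_LFunction_zero χ₁ hχ₁ hz₁
  have hδ₂0 : 0 < δ₂ := pos_of_LFunction_zero χ₂ hχ₂ hz₂
  -- suppose both zeros lie in the window
  by_contra hcon
  push Not at hcon
  have hδ₁ : δ₁ ≤ (1 - η') / Real.log ((D₁ * D₂ : ℕ) : ℝ) := (le_max_left _ _).trans hcon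
  have hδ₂ : δ₂ ≤ (1 - η') / Real.log ((D₁ * D₂ : ℕ) : ℝ) := (le_max_right _ _).trans hcon
  obtain ⟨hNe, hAN, herr⟩ := hQ₀ (D₁ * D₂) hQ₀Q
  set Q : ℕ := D₁ * D₂ with hQdef
  haveI : NeZero Q := ⟨Nat.mul_ne_zero (NeZero.ne D₁) (NeZero.ne D₂)⟩
  set ℓ : ℝ := 1 + Real.log Q with hℓdef
  set N : ℕ := ⌊(Q : ℝ) ^ (1 / (1 - η'))⌋₊ with hNdef
  have hℓ1 : 1 ≤ ℓ := by rw [hℓdef]; linarith only [hlogQ1]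
  -- `log D_i ≤ log Q`
  have hD₁1 : (1 : ℝ) ≤ D₁ := by exact_mod_cast (le_trans one_le_two hD₁2)
  have hD₂1 : (1 : ℝ) ≤ D₂ := by exact_mod_cast (le_trans one_le_two hD₂2)
  have hQprod : (Q : ℝ) = (D₁ : ℝ) * D₂ := by rw [hQdef]; push_cast; ring
  have hlogD₁ : Real.log D₁ ≤ Real.log Q := by
    refine Real.log_le_log (by linarith only [hD₁1]) ?_
    rw [hQprod]; exact le_mul_of_one_le_right (by linarith only [hD₁1]) hD₂1
  have hlogD₂ : Real.log D₂ ≤ Real.log Q := by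
    refine Real.log_le_log (by linarith only [hD₂1]) ?_
    rw [hQprod]; exact le_mul_of_one_le_left (by linarith only [hD₂1]) hD₁1
  have hlogD₁0 : 0 ≤ Real.log D₁ := Real.log_nonneg hD₁1
  have hlogD₂0 : 0 ≤ Real.log D₂ := Real.log_nonneg hD₂1
  -- the partial-sum bounds `A₁ = √D₁ ℓ`, `A₂ = √D₂ ℓ`, `A₃ = τ(Q) √Q ℓ` and `|L(1,χ_i)| ≤ ℓ`
  have hℓD₁ : 1 + Real.log D₁ ≤ ℓ := by rw [hℓdef]; linarith only [hlogD₁]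
  have hℓD₂ : 1 + Real.log D₂ ≤ ℓ := by rw [hℓdef]; linarith only [hlogD₂]
  have hA₁ : ∀ n, ‖partialSum χ₁ n‖ ≤ Real.sqrt D₁ * ℓ := fun n =>
    (norm_partialSum_le_polyaVinogradov χ₁ hD₁2 hχ₁p n).trans
      (mul_le_mul_of_nonneg_left hℓD₁ (Real.sqrt_nonneg _))
  have hA₂ : ∀ n, ‖partialSum χ₂ n‖ ≤ Real.sqrt D₂ * ℓ := fun n =>
    (norm_partialSum_le_polyaVinogradov χ₂ hD₂2 hχ₂p n).trans
      (mul_le_mul_of_nonneg_left hℓD₂ (Real.sqrt_nonneg _))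
  have hA₃ : ∀ n, ‖partialSum (prodChar χ₁ χ₂) n‖ ≤
      ((ArithmeticFunction.sigma 0 Q : ℕ) : ℝ) * Real.sqrt Q * ℓ := by
    intro n
    rw [partialSum_eq_sum_Ioc]
    exact Literature.NumberTheory.Sieve.FriedlanderIwaniecPrimes.norm_sum_Ioc_le_of_ne_one hψ 0 (0 + n)
  have hL₁ : ‖χ₁.LFunction 1‖ ≤ ℓ :=
    (norm_LFunction_one_le_log χ₁ hχ₁).trans (by linarith only [hℓD₁, hlogD₁0])
  have hL₂ : ‖χ₂.LFunction 1‖ ≤ ℓ :=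
    (norm_LFunction_one_le_log χ₂ hχ₂).trans (by linarith only [hℓD₂, hlogD₂0])
  have hsqD₁ : 1 ≤ Real.sqrt D₁ := Real.one_le_sqrt.mpr hD₁1
  have hsqD₂ : 1 ≤ Real.sqrt D₂ := Real.one_le_sqrt.mpr hD₂1
  have hQ1r : (1 : ℝ) ≤ Q := by linarith only [hQ3r]
  have hsqQ : 1 ≤ Real.sqrt Q := Real.one_le_sqrt.mpr hQ1r
  have hτ1 : (1 : ℝ) ≤ ((ArithmeticFunction.sigma 0 Q : ℕ) : ℝ) := by
    have : 0 < ArithmeticFunction.sigma 0 Q := by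
      rw [ArithmeticFunction.sigma_zero_apply]
      exact Finset.card_pos.mpr ⟨1, Nat.one_mem_divisors.mpr (NeZero.ne Q)⟩
    exact_mod_cast this
  have hA₁1 : 1 ≤ Real.sqrt D₁ * ℓ := one_le_mul_of_one_le_of_one_le hsqD₁ hℓ1
  have hA₂1 : 1 ≤ Real.sqrt D₂ * ℓ := one_le_mul_of_one_le_of_one_le hsqD₂ hℓ1
  have hA₃1 : 1 ≤ ((ArithmeticFunction.sigma 0 Q : ℕ) : ℝ) * Real.sqrt Q * ℓ :=
    one_le_mul_of_one_le_of_one_le (one_le_mul_of_one_le_of_one_le hτ1 hsqQ) hℓ1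
  have hAeq : Real.sqrt D₁ * ℓ * (Real.sqrt D₂ * ℓ) *
      (((ArithmeticFunction.sigma 0 Q : ℕ) : ℝ) * Real.sqrt Q * ℓ) =
      ((ArithmeticFunction.sigma 0 Q : ℕ) : ℝ) * Q * ℓ ^ 3 := by
    have h12 : Real.sqrt D₁ * Real.sqrt D₂ = Real.sqrt Q := by
      rw [← Real.sqrt_mul (by linarith only [hD₁1]), hQprod]
    have hQQ : Real.sqrt Q * Real.sqrt Q = Q := Real.mul_self_sqrt hQ0r.le
    calc Real.sqrt D₁ * ℓ * (Real.sqrt D₂ * ℓ) *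
        (((ArithmeticFunction.sigma 0 Q : ℕ) : ℝ) * Real.sqrt Q * ℓ)
        = ((ArithmeticFunction.sigma 0 Q : ℕ) : ℝ) * ((Real.sqrt D₁ * Real.sqrt D₂) * Real.sqrt Q) *
            ℓ ^ 3 := by ring
      _ = ((ArithmeticFunction.sigma 0 Q : ℕ) : ℝ) * Q * ℓ ^ 3 := by rw [h12, hQQ]
  have hNA : Real.sqrt D₁ * ℓ * (Real.sqrt D₂ * ℓ) *
      (((ArithmeticFunction.sigma 0 Q : ℕ) : ℝ) * Real.sqrt Q * ℓ) ≤ N := by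
    rw [hAeq]; exact hAN
  have herr' : 9 * Real.exp 1 * (864 * ℓ ^ 2 / (η' / 64) ^ 2 *
      (Real.sqrt D₁ * ℓ * (Real.sqrt D₂ * ℓ) *
        (((ArithmeticFunction.sigma 0 Q : ℕ) : ℝ) * Real.sqrt Q * ℓ)) ^ (1 / 4 : ℝ)) *
      (N : ℝ) ^ (-(1 / 4 - η' / 64)) * (Real.log N + 8) < Real.log 4 / 4 := by
    rw [hAeq]; exact herr
  -- the window contains both zeros: `(1 − η')/log Q ≤ 1/log N`
  have hN0 : (0 : ℝ) < N := lt_of_lt_of_le (Real.exp_pos 16) hNe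
  have hlogN16 : 16 ≤ Real.log N := by
    rw [← Real.log_exp 16]; exact Real.log_le_log (Real.exp_pos 16) hNe
  have h1η : 0 < 1 - η' := by linarith only [hη'1]
  have hwin : (1 - η') / Real.log Q ≤ 1 / Real.log N := by
    have hNle : (N : ℝ) ≤ (Q : ℝ) ^ (1 / (1 - η')) := Nat.floor_le (Real.rpow_nonneg hQ0r.le _)
    have hlogN : Real.log N ≤ 1 / (1 - η') * Real.log Q := by
      calc Real.log N ≤ Real.log ((Q : ℝ) ^ (1 / (1 - η'))) := Real.log_le_log hN0 hNle
        _ = 1 / (1 - η') * Real.log Q := Real.log_rpow hQ0r _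
    rw [div_le_div_iff₀ hlogQ0 (by linarith only [hlogN16]), one_mul]
    have := mul_le_mul_of_nonneg_left hlogN h1η.le
    rw [← mul_assoc, mul_one_div_cancel h1η.ne', one_mul] at this
    exact this
  have h₁ : 1 - 1 / Real.log N ≤ 1 - δ₁ := by linarith only [hδ₁, hwin]
  have h₂ : 1 - 1 / Real.log N ≤ 1 - δ₂ := by linarith only [hδ₂, hwin]
  have hδs : η' / 64 ≤ 1 / 16 := by linarith only [hη'1]
  have h₁' : 1 - δ₁ < 1 := by linarith only [hδ₁0]
  have h₂' : 1 - δ₂ < 1 := by linarith only [hδ₂0]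
  exact landau_window χ₁ χ₂ hχ₁ hq₁ hχ₂ hq₂ hψ hA₁1 hA₂1 hA₃1 hℓ1 hA₁ hA₂ hA₃ hL₁ hL₂
    (by positivity : 0 < η' / 64) hδs hNe hNA herr' h₁ h₁' h₂ h₂' hz₁ hz₂

end Discharge

end Literature.NumberTheory.LFunctions
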